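import Literature.NumberTheory.Irrationality.KrattenthalerRivoal2007.PropositionSevenReduction
import HarnessLib

/-!
# Proposition 7: the brick decomposition of the tail multiple sums `gTailEven` / `gTailOdd` (general `k ≥ 1`)

[KrattenthalerRivoal2007, §13, proof of Proposition 7, display (eq:briques)]: the right-hand side of Corollaire 1
(general `k`; Corollaire 2 for odd `A`), multiplied by `(rn)!^{2B}/n!^{2rB}`, is written level by level as an integer
times a product of elementary bricks `R(α,β;±ε+K)`, `ε·R(α,β;±ε)`, special bricks `R₁(n,n−k−i_j,n−i_j+i_{j−1};ε)`
(Lemme 10) and, at the top, `R₇ = ε·R₃(n,k,i_m,i_{m−1};ε)` (Lemme 11) or seven elementary bricks when `i_m = i_{m−1}`;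
hence every Taylor coefficient at `ε = 0`, times the matching power of `d_n`, is an integer.

This file carries this out for the tree's normal form (`PropositionSevenReduction.lean`: `gTailEven`, `gTailOdd`,
chain `corOneParamsK`/`corTwoParamsK` at `a = −N+k−2ε`, `x' = −N−ε`, `c₂ = 1+k−2ε`, `y' = rn+k+1−ε`, `n = k+N`):
* `linkTailCore` — the generic inner factor `linkTailProd a L i (N−i) · linkReducedMultiSum a L i` of a sub-chain and
  its one-step Bailey recursion `linkTailCore_cons_some` (all levels of both chains are instances);
* the normalised levels `lvYK` (`∏_q R(n,0;k+i+qn+1−ε) · R₁(n,N−j,n−j+i;ε)`), `lvXK` (reciprocal bricks), the top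
  `topBK` (`ε·R₃ · k/(k−2ε) · R(0,k;−ε)(−ε)` resp. the elementary product), each `IsDInt (d_n)` at `0`;
* the level identities (raw level × normaliser = integer × bricks), the dictionaries `rawYK_dictionary`,
  `rawXK_dictionary`, and the assembly **`gTailEven_eq_bricks`** / **`gTailOdd_eq_bricks`**;
* **`gTailEven_isDInt`** (`k ≥ 1`, `B ≥ 1`, `r ≥ 1`) and **`gTailOdd_isDInt`** (`k ≥ 1`, `r ≥ 1`, every `B`): all
  Taylor coefficients of the tail multiple sums at `0`, times the matching power of `d_n`, are integers.
* the case `B = 0` (`rawK_dict_even_base`, `gTailEven_eq_bricks_zero`, `gTailEven_isDInt_zero`), through which `r = 0`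
  is routed (`numeratorR n A B 0 = numeratorR n A 0 0`, `gTailEven/Odd_zero_B_zero_r`), and finally
  **`theoreme1_holds : theoreme1`** — [KrattenthalerRivoal2007, Théorème 1] is a theorem of the tree (clause (i):
  `theoreme1_i`, Proposition 6; clause (ii): Proposition 7 via `theoreme1_of_prop7`).
Exact-arithmetic replay of every identity below (random parameters, Taylor order 7): custody `tools/check_prop7_units.py`,
`tools/check_prop7_final.py`.

## References
* [KrattenthalerRivoal2007] C. Krattenthaler, T. Rivoal, *Hypergéométrie et fonction zêta de Riemann*, Mem. AMS 186
  (2007), §13 proof of Proposition 7 (eq:briques); §11 Lemmes 9–11; §9 Corollaires 1–2 (arXiv:math/0311114 pp. 21,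
  24–25, 30–31).
-/

open Finset Filter
open scoped Nat
open Literature.NumberTheory.Transcendental
open Literature.Combinatorics.Enumerative.BaileyChain

namespace Literature.NumberTheory.Irrationality.KrattenthalerRivoal2007

/-! ### Rising factorials (private shorthand) -/

/-- `(z)_m` (private shorthand). [folklore] -/
private def pw (z : ℚ) (m : ℕ) : ℚ := ∏ i ∈ range m, (z + i)

/-- Unfolding. [folklore] -/
private theorem pw_def (z : ℚ) (m : ℕ) : pw z m = ∏ i ∈ range m, (z + i) := rfl

/-- `(z)_{m₁+m₂} = (z)_{m₁}(z+m₁)_{m₂}`. [folklore] -/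
private theorem pw_add (z : ℚ) (m₁ m₂ : ℕ) : pw z (m₁ + m₂) = pw z m₁ * pw (z + m₁) m₂ := by
  simp only [pw, prod_range_add]
  congr 1
  refine prod_congr rfl fun i _ => ?_
  push_cast
  ring

/-- Congruence. [folklore] -/
private theorem pw_congr {z z' : ℚ} (h : z = z') (m : ℕ) : pw z m = pw z' m := by rw [h]

/-- `(z)_{m+1} = (z)_m (z+m)`. [folklore] -/
private theorem pw_succ (z : ℚ) (m : ℕ) : pw z (m + 1) = pw z m * (z + m) := by
  simp [pw, prod_range_succ]

/-- `(z)_{m+1} = z (z+1)_m`. [folklore] -/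
private theorem pw_succ_left (z : ℚ) (m : ℕ) : pw z (m + 1) = z * pw (z + 1) m := by
  induction m with
  | zero => simp [pw]
  | succ m ih =>
    rw [pw_succ, ih, pw_succ]
    push_cast
    ring

/-- Reflection `(−z)_m = (−1)^m (z−m+1)_m`. [folklore] -/
private theorem pw_neg_rev (z : ℚ) (m : ℕ) : pw (-z) m = (-1) ^ m * pw (z - m + 1) m := by
  induction m with
  | zero => simp [pw]
  | succ m ih =>
    rw [pw_succ, ih, pw_succ_left,
      pw_congr (show z - ((m + 1 : ℕ) : ℚ) + 1 + 1 = z - (m : ℕ) + 1 by push_cast; ring) m]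
    push_cast
    ring

/-- Blocks: `(z)_{rn} = ∏_{q<r} (z+qn)_n`. [folklore] -/
private theorem pw_mul_blocks (z : ℚ) (r n : ℕ) : pw z (r * n) = ∏ q ∈ range r, pw (z + q * n) n := by
  induction r with
  | zero => simp [pw]
  | succ r ih =>
    rw [Nat.succ_mul, pw_add, ih, prod_range_succ]
    congr 1
    exact pw_congr (by push_cast; ring) n

/-- `(1)_m = m!`. [folklore] -/
private theorem pw_one (m : ℕ) : pw 1 m = (m ! : ℚ) := by
  induction m with
  | zero => simp [pw]
  | succ m ih => rw [pw_succ, ih, Nat.factorial_succ]; push_cast; ring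

/-- `(−m)_m = (−1)^m m!` for a natural `m`. [folklore] -/
private theorem pw_neg_nat (m : ℕ) : pw (-(m : ℚ)) m = (-1) ^ m * (m ! : ℚ) := by
  rw [pw_neg_rev, pw_congr (show (m : ℚ) - m + 1 = 1 by ring), pw_one]

/-- `∏_{f ∈ (a, a+m]} (f + t) = (a+1+t)_m`. [folklore] -/
private theorem prod_Ioc_add_eq_pw (a m : ℕ) (t : ℚ) : ∏ f ∈ Ioc a (a + m), ((f : ℚ) + t) = pw ((a : ℚ) + 1 + t) m := by
  induction m with
  | zero => simp [pw]
  | succ m ih =>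
    rw [← Nat.add_assoc, Finset.prod_Ioc_succ_top (by omega), ih, pw_succ]
    push_cast
    ring

/-- The block bricks times `n!^r` are plain Pochhammer symbols. [folklore] -/
private theorem pbBlockMinus_mul' (n r K : ℕ) (ε : ℚ) :
    pbBlockMinus n r K ε * (n ! : ℚ) ^ r = pw ((K : ℚ) - ε) (r * n) := by
  unfold pbBlockMinus polyBrick
  rw [prod_div_distrib, prod_const, card_range, div_mul_cancel₀ _ (by positivity), pw_mul_blocks]
  refine prod_congr rfl fun q _ => ?_
  rw [← pw_def]
  exact pw_congr (by push_cast; ring) _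

/-! ### The generic inner factor of a sub-chain and its Bailey recursion -/

/-- The inner factor of a link sub-chain `L` at outer index `i` (length `N`):
`linkTailCore a L N i = linkTailProd a L i (N−i) · linkReducedMultiSum a L i`.
[cite: KrattenthalerRivoal2007, §6 Théorème 8 (the multiple sum, one level at a time)] -/
def linkTailCore (a : ℚ) (L : List (ℚ × Option ℚ)) (N i : ℕ) : ℚ :=
  linkTailProd a L i (N - i) * linkReducedMultiSum a L i

/-- Empty sub-chain: `[i = 0]`. [cite: KrattenthalerRivoal2007, §6 Théorème 8] -/
theorem linkTailCore_nil (a : ℚ) (N i : ℕ) : linkTailCore a [] N i = if i = 0 then 1 else 0 := by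
  unfold linkTailCore
  rw [linkReducedMultiSum_nil]
  simp [linkTailProd]

/-- A single unpaired parameter: `linkTailCore a [(b,∞)] N i = (1+a−b+i)_{N−i}`.
[cite: KrattenthalerRivoal2007, §9 proof of Corollaire 2] -/
theorem linkTailCore_single_none (a b : ℚ) (N i : ℕ) :
    linkTailCore a [(b, none)] N i = ∏ l ∈ range (N - i), (1 + a - b + i + (l : ℚ)) := by
  unfold linkTailCore
  rw [linkReducedMultiSum_cons_none]
  have h : ∑ x ∈ range (i + 1), (-1 : ℚ) ^ x * (i.choose x : ℚ) * (∏ j ∈ range x, (b + j)) *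
      linkTailProd a [] x (i - x) * linkReducedMultiSum a [] x = 1 := by
    rw [sum_eq_single 0 (fun x _ hx => by rw [linkReducedMultiSum_nil, if_neg hx]; ring)
      (fun h => absurd (mem_range.2 (Nat.succ_pos i)) h)]
    simp [linkReducedMultiSum_nil, linkTailProd]
  rw [h]
  simp [linkTailProd]

/-- Running product of a cons (local unfolding). [folklore] -/
private theorem linkTailProd_cons_some' (a b c : ℚ) (L : List (ℚ × Option ℚ)) (k : ℚ) (m : ℕ) :
    linkTailProd a ((b, some c) :: L) k m =
      (∏ i ∈ range m, (1 + a - b + k + (i : ℚ))) * (∏ i ∈ range m, (1 + a - c + k + (i : ℚ))) *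
        linkTailProd a L k m := by
  simp only [linkTailProd, List.map_cons, List.prod_cons, Option.elim_some, mul_assoc]

/-- Gluing of running products along a link list (`i ≤ k ≤ N`). [folklore] -/
private theorem linkTailProd_glue (a : ℚ) (L : List (ℚ × Option ℚ)) {i k N : ℕ} (hik : i ≤ k) (hkN : k ≤ N) :
    linkTailProd a L (k : ℚ) (N - k) * linkTailProd a L (i : ℚ) (k - i) = linkTailProd a L (i : ℚ) (N - i) := by
  induction L with
  | nil => simp [linkTailProd]
  | cons l L ih =>
    obtain ⟨b, c⟩ := l
    have hb : (∏ j ∈ range (N - k), (1 + a - b + (k : ℚ) + (j : ℚ))) * ∏ j ∈ range (k - i), (1 + a - b + (i : ℚ) + (j : ℚ)) =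
        ∏ j ∈ range (N - i), (1 + a - b + (i : ℚ) + (j : ℚ)) := by
      rw [← pw_def, ← pw_def, ← pw_def, show N - i = (k - i) + (N - k) by omega, pw_add,
        pw_congr (show 1 + a - b + (i : ℚ) + ((k - i : ℕ) : ℚ) = 1 + a - b + (k : ℚ) by rw [Nat.cast_sub hik]; ring)]
      ring
    cases c with
    | none =>
      simp only [linkTailProd, List.map_cons, List.prod_cons, Option.elim_none, mul_one] at ih ⊢
      rw [← ih, ← hb]
      ring
    | some c =>
      have hc : (∏ j ∈ range (N - k), (1 + a - c + (k : ℚ) + (j : ℚ))) * ∏ j ∈ range (k - i), (1 + a - c + (i : ℚ) + (j : ℚ)) =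
          ∏ j ∈ range (N - i), (1 + a - c + (i : ℚ) + (j : ℚ)) := by
        rw [← pw_def, ← pw_def, ← pw_def, show N - i = (k - i) + (N - k) by omega, pw_add,
          pw_congr (show 1 + a - c + (i : ℚ) + ((k - i : ℕ) : ℚ) = 1 + a - c + (k : ℚ) by rw [Nat.cast_sub hik]; ring)]
        ring
      simp only [linkTailProd, List.map_cons, List.prod_cons, Option.elim_some] at ih ⊢
      rw [← ih, ← hb, ← hc]
      ring

/-- **One Bailey step** of the inner factor: for `i ≤ N`,
`core((b,c)::L)(i) = (1+a−b+i)_{N−i} (1+a−c+i)_{N−i} Σ_{j≤i} C(i,j) (1+a−b−c)_{i−j} (b)_j (c)_j core(L)(j)`.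
[cite: KrattenthalerRivoal2007, §6 Théorème 8] -/
theorem linkTailCore_cons_some (a b c : ℚ) (L : List (ℚ × Option ℚ)) {N i : ℕ} (hi : i ≤ N) :
    linkTailCore a ((b, some c) :: L) N i =
      (∏ l ∈ range (N - i), (1 + a - b + i + (l : ℚ))) * (∏ l ∈ range (N - i), (1 + a - c + i + (l : ℚ))) *
        ∑ j ∈ range (i + 1), (i.choose j : ℚ) * (∏ l ∈ range (i - j), (1 + a - b - c + (l : ℚ))) *
          (∏ l ∈ range j, (b + (l : ℚ))) * (∏ l ∈ range j, (c + (l : ℚ))) * linkTailCore a L N j := by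
  unfold linkTailCore
  rw [linkReducedMultiSum_cons_some, linkTailProd_cons_some']
  simp only [mul_sum]
  refine sum_congr rfl fun j hj => ?_
  have hji : j ≤ i := Nat.lt_succ_iff.mp (mem_range.mp hj)
  rw [← linkTailProd_glue a L hji hi]
  ring

/-- Over full pairs the link objects are the plain ones: running product. [folklore] -/
private theorem linkTailProd_map_some (a : ℚ) (L : List (ℚ × ℚ)) (k : ℚ) (m : ℕ) :
    linkTailProd a (L.map fun bc => (bc.1, some bc.2)) k m = tailProd a L k m := by
  induction L with
  | nil => simp [linkTailProd, tailProd]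
  | cons bc L ih =>
    simp only [linkTailProd, tailProd, List.map_cons, List.prod_cons, Option.elim_some] at ih ⊢
    rw [ih]

/-- Over full pairs `linkReducedMultiSum = reducedMultiSum`. [cite: KrattenthalerRivoal2007, §6 Théorème 8] -/
theorem linkReducedMultiSum_map_some (a : ℚ) (L : List (ℚ × ℚ)) :
    ∀ i : ℕ, linkReducedMultiSum a (L.map fun bc => (bc.1, some bc.2)) i = reducedMultiSum a L i := by
  induction L with
  | nil => intro i; simp [linkReducedMultiSum_nil, reducedMultiSum_nil]
  | cons bc L ih =>
    intro i
    obtain ⟨b, c⟩ := bc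
    rw [List.map_cons, linkReducedMultiSum_cons_some, reducedMultiSum_cons]
    refine sum_congr rfl fun j _ => ?_
    rw [ih j, linkTailProd_map_some]


/-! ### Two more elementary bricks: `f/(f−2ε)` and `k!/(1−2ε)_k` (KR's `(−2ε)·R(0,k;−2ε)`) -/

/-- Every `1 ≤ f ≤ n` divides `d_n`. [folklore] -/
private theorem dvd_lcmUpto' {f n : ℕ} (h1 : 1 ≤ f) (h2 : f ≤ n) : f ∣ Nat.lcmUpto n :=
  Finset.dvd_lcm (Finset.mem_Icc.2 ⟨h1, h2⟩)

/-- `f/(f−2ε) = Σ_m (2ε/f)^m` is `IsDInt (d_n)` at `0` for `1 ≤ f ≤ n` (`d_n^m (2/f)^m ∈ ℤ`).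
[cite: KrattenthalerRivoal2007, §11 Lemme 9 (bricks in ±2ε: R(0,k;−2ε)), §13 (eq:briques)] -/
theorem twoEpsRecip_isDInt {f n : ℕ} (hf : 1 ≤ f) (hfn : f ≤ n) (N' : ℕ) :
    IsDInt (Nat.lcmUpto n) N' (fun ε => (f : ℚ) / ((f : ℚ) - 2 * ε)) 0 := by
  have hf0 : (f : ℚ) ≠ 0 := by positivity
  have hc : (0 : ℚ) + (-(f : ℚ) / 2) ≠ 0 := by
    rw [zero_add, neg_div, neg_ne_zero]; positivity
  have hform : (fun ε : ℚ => (f : ℚ) / ((f : ℚ) - 2 * ε)) = fun ε => (-(f : ℚ) / 2) * (ε + (-(f : ℚ) / 2))⁻¹ := by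
    funext ε
    rw [show (f : ℚ) - 2 * ε = (-2) * (ε + (-(f : ℚ) / 2)) by ring, div_eq_mul_inv, mul_inv]
    ring
  rw [hform]
  refine ⟨contDiffAt_const.mul (Literature.Analysis.Calculus.contDiffAt_inv_add_const hc), fun j _ => ?_⟩
  rw [Literature.Analysis.Calculus.divDeriv_const_mul, Literature.Analysis.Calculus.divDeriv_inv_add_const j hc]
  obtain ⟨e, he⟩ := dvd_lcmUpto' hf hfn
  refine ⟨(2 * e) ^ j, ?_⟩
  have hu : (-(f : ℚ) / 2) ≠ 0 := by rw [neg_div, neg_ne_zero]; positivity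
  have key : (-(f : ℚ) / 2) * ((-1 : ℚ) ^ j / (0 + -(f : ℚ) / 2) ^ (j + 1)) = (2 / (f : ℚ)) ^ j := by
    calc (-(f : ℚ) / 2) * ((-1 : ℚ) ^ j / (0 + -(f : ℚ) / 2) ^ (j + 1))
        = (-1 : ℚ) ^ j / (-(f : ℚ) / 2) ^ j := by
          rw [zero_add, pow_succ]
          field_simp
      _ = ((-1 : ℚ) / (-(f : ℚ) / 2)) ^ j := by rw [← div_pow]
      _ = (2 / (f : ℚ)) ^ j := by
          congr 1
          rw [div_eq_iff hu]
          field_simp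
  rw [key, he]
  push_cast
  rw [← mul_pow]
  congr 1
  field_simp

/-- `k!/(1−2ε)_k = ∏_{f=1}^{k} f/(f−2ε)` is `IsDInt (d_n)` at `0` for `k ≤ n`.
[cite: KrattenthalerRivoal2007, §11 Lemme 9; §13 (the brick (−2ε)·R(0,k;−2ε))] -/
theorem twoEpsRecipFact_isDInt {k n : ℕ} (hk : k ≤ n) (N' : ℕ) :
    IsDInt (Nat.lcmUpto n) N' (fun ε => (k ! : ℚ) / ∏ l ∈ range k, (1 - 2 * ε + (l : ℚ))) 0 := by
  have h : IsDInt (Nat.lcmUpto n) N' (fun ε => ∏ l ∈ range k, (((l + 1 : ℕ) : ℚ) / (((l + 1 : ℕ) : ℚ) - 2 * ε))) 0 :=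
    IsDInt.prod _ fun l hl => twoEpsRecip_isDInt (by omega) (by have := mem_range.1 hl; omega) N'
  refine h.congr (Eventually.of_forall fun ε => ?_)
  simp only
  rw [prod_div_distrib]
  congr 1
  · rw [← prod_range_add_one_eq_factorial, Nat.cast_prod]
  · exact prod_congr rfl fun l _ => by push_cast; ring

/-- `ε ↦ ε·R₃(n,k,m₁,m₂;ε)` is `IsDInt (d_n)` at `0` (KR's `R₇ = ε·R₃`, from Lemme 11: `d_n·R₃` is, and `ε/d_n` is).
[cite: KrattenthalerRivoal2007, §11 Lemme 11; §13 («pour ℓ₀ ≥ 1 on a …»)] -/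
theorem eps_mul_specialBrickR3_isDInt (n k m₁ m₂ : ℕ) (hk : 1 ≤ k) (hm : m₂ < m₁) (hmn : k + m₁ ≤ n) (N' : ℕ) :
    IsDInt (Nat.lcmUpto n) N' (fun ε => ε * specialBrickR3 n k m₁ m₂ ε) 0 := by
  have hd : (Nat.lcmUpto n : ℚ) ≠ 0 := by
    have := Nat.lcmUpto_pos n
    positivity
  have h1 : IsDInt (Nat.lcmUpto n) N' (fun ε : ℚ => (1 / (Nat.lcmUpto n : ℚ)) * ε + 0) 0 :=
    IsDInt.affine _ N' ⟨0, by simp⟩ ⟨1, by field_simp; simp⟩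
  refine ((h1.mul (specialBrickR3_isDInt n k m₁ m₂ hk hm hmn N')).congr (Eventually.of_forall fun ε => ?_))
  simp only [add_zero, one_div]
  field_simp

/-- `R(α,β;−2ε+K)`-type polynomial brick at `−2ε`: `IsDInt (d_n)` for length `m ≤ n`.
[cite: KrattenthalerRivoal2007, §11 Lemme 9; §13 (the brick R(k+i,0;1−2ε))] -/
theorem polyBrick_neg_two_eps_isDInt (K : ℤ) {m n : ℕ} (hmn : m ≤ n) (N' : ℕ) :
    IsDInt (Nat.lcmUpto n) N' (fun ε => polyBrick K m (-(2 * ε))) 0 := by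
  have h := polyBrick_two_eps_isDInt K hmn N'
  rw [← neg_zero] at h
  exact h.comp_neg.congr (Eventually.of_forall fun ε => by simp only; ring_nf)

/-! ### The normalised levels (general `k`) -/

/-- The `(x',y')`-level of the tail chain with outer index `i` and inner index `j` (`n = k+N`):
`∏_{q<r} R(n,0; k+j+qn+1−ε) · R₁(n, N−i, n−i+j; ε)` — KR's `(∏_q R(n,0;k+i_{j−1}+qn+1−ε)) R₁(n,n−k−i_j,n−i_j+i_{j−1};ε)`.
[cite: KrattenthalerRivoal2007, §13 (eq:briques), second line] -/
def lvYK (k N r i j : ℕ) (ε : ℚ) : ℚ :=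
  pbBlockMinus (k + N) r (k + j + 1) ε * specialBrickR1 (k + N) r (N - i) (k + N - i + j) ε

/-- The `(x',x')`-level: `C(i,j) C(n+i−j,k+i) C(n,k+j) · R(0,k+i+1;−ε)(−ε) R(0,k+j+1;−ε)(−ε) (R(0,N−j+1;ε)ε)²`
(KR's fourth/fifth lines of (eq:briques), normalised). [cite: KrattenthalerRivoal2007, §13 (eq:briques)] -/
def lvXK (k N i j : ℕ) (ε : ℚ) : ℚ :=
  ((i.choose j * ((k + N + i - j).choose (k + i)) * ((k + N).choose (k + j)) : ℕ) : ℚ) *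
    rbMinus (k + i) ε * rbMinus (k + j) ε * rbPlus (N - j) ε ^ 2

/-- The top of the tail chain (indices `i = i_m ≥ j = i_{m−1}`): for `j < i` KR's `R₇ = ε·R₃(n,k,i,j;ε)` times
`k/(k−2ε) · R(0,k;−ε)(−ε)`; for `j = i` the elementary product
`R(k+i,0;1−2ε) · (−2ε)R(0,k+1;−2ε) · (−ε)R(0,n+1;−ε) · R(n−i−1,0;1−ε) · C(n−i−1,k−1) R(0,k;−ε)(−ε) R(0,N−i+1;ε)ε · R(0,k+i+1;−ε)(−ε)`.
[cite: KrattenthalerRivoal2007, §13 proof of Proposition 7 (the two cases i_{A/2+B} = / > i_{A/2+B−1})] -/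
def topBK (k N i j : ℕ) (ε : ℚ) : ℚ :=
  if j < i then ε * specialBrickR3 (k + N) k i j ε * ((k : ℚ) / ((k : ℚ) - 2 * ε)) * rbMinus (k - 1) ε
  else polyBrick 1 (k + i) (-(2 * ε)) * ((k ! : ℚ) / ∏ l ∈ range k, (1 - 2 * ε + (l : ℚ))) * rbMinus (k + N) ε *
    polyBrick 1 (k + N - i - 1) (-ε) * (((k + N - i - 1).choose (k - 1) : ℕ) : ℚ) * rbMinus (k - 1) ε *
    rbPlus (N - i) ε * rbMinus (k + i) ε

/-- `lvYK` is `IsDInt (d_n)` at `0` (`r ≥ 1`, `j ≤ i ≤ N`; Lemmes 9–10). [cite: KrattenthalerRivoal2007, §13 proof of Prop. 7] -/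
theorem lvYK_isDInt {k N r i j : ℕ} (hr : 1 ≤ r) (hji : j ≤ i) (hi : i ≤ N) (N' : ℕ) :
    IsDInt (Nat.lcmUpto (k + N)) N' (lvYK k N r i j) 0 :=
  (pbBlockMinus_isDInt (n := k + N) (r := r) (k + j + 1) N').mul
    (specialBrickR1_isDInt (k + N) r (N - i) (k + N - i + j) hr (by omega) N')

/-- `lvXK` is `IsDInt (d_n)` at `0` (`j ≤ i ≤ N`; Lemme 9). [cite: KrattenthalerRivoal2007, §13 proof of Prop. 7] -/
theorem lvXK_isDInt {k N i j : ℕ} (hji : j ≤ i) (hi : i ≤ N) (N' : ℕ) :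
    IsDInt (Nat.lcmUpto (k + N)) N' (lvXK k N i j) 0 := by
  have h0 : IsDInt (Nat.lcmUpto (k + N)) N'
      (fun _ : ℚ => (((i.choose j * ((k + N + i - j).choose (k + i)) * ((k + N).choose (k + j)) : ℕ) : ℤ) : ℚ)) 0 :=
    IsDInt.const _ N' _ 0
  have h1 := rbMinus_isDInt (n := k + N) (i := k + i) (by omega) N'
  have h2 := rbMinus_isDInt (n := k + N) (i := k + j) (by omega) N'
  have h3 := (rbPlus_isDInt (n := k + N) (i := N - j) (by omega) N').pow 2
  refine (((h0.mul h1).mul h2).mul h3).congr (Eventually.of_forall fun ε => ?_)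
  simp only [lvXK, Int.cast_natCast]

/-- `topBK` is `IsDInt (d_n)` at `0` (`1 ≤ k`, `j ≤ i ≤ N`; Lemmes 9 and 11). [cite: KrattenthalerRivoal2007, §13 proof of Prop. 7] -/
theorem topBK_isDInt {k N i j : ℕ} (hk : 1 ≤ k) (hji : j ≤ i) (hi : i ≤ N) (N' : ℕ) :
    IsDInt (Nat.lcmUpto (k + N)) N' (topBK k N i j) 0 := by
  unfold topBK
  split_ifs with h
  · have h1 := eps_mul_specialBrickR3_isDInt (k + N) k i j hk h (by omega) N'
    have h2 := twoEpsRecip_isDInt (n := k + N) hk (by omega) N'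
    have h3 := rbMinus_isDInt (n := k + N) (i := k - 1) (by omega) N'
    exact (h1.mul h2).mul h3
  · have h1 := polyBrick_neg_two_eps_isDInt 1 (m := k + i) (n := k + N) (by omega) N'
    have h2 := twoEpsRecipFact_isDInt (k := k) (n := k + N) (by omega) N'
    have h3 := rbMinus_isDInt (n := k + N) (i := k + N) le_rfl N'
    have h4 := polyBrick_neg_eps_isDInt 1 (m := k + N - i - 1) (n := k + N) (by omega) N'
    have h5 : IsDInt (Nat.lcmUpto (k + N)) N' (fun _ : ℚ => ((((k + N - i - 1).choose (k - 1) : ℕ) : ℤ) : ℚ)) 0 :=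
      IsDInt.const _ N' _ 0
    have h6 := rbMinus_isDInt (n := k + N) (i := k - 1) (by omega) N'
    have h7 := rbPlus_isDInt (n := k + N) (i := N - i) (by omega) N'
    have h8 := rbMinus_isDInt (n := k + N) (i := k + i) (by omega) N'
    refine (((((((h1.mul h2).mul h3).mul h4).mul h5).mul h6).mul h7).mul h8).congr (Eventually.of_forall fun ε => ?_)
    simp only [Int.cast_natCast]

/-! ### The normalised inner sums -/

/-- The normalised tail chain: `m` levels `(x',x')`, then `b` levels `(x',y')`, on the even base `[j = 0]` or the odd
base `1` (the unpaired `x'`); outer index `i`. [cite: KrattenthalerRivoal2007, §13 (eq:briques)] -/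
def innerK (k N r : ℕ) (odd : Bool) : ℕ → ℕ → ℕ → ℚ → ℚ
  | 0, 0, i, _ => if odd then 1 else if i = 0 then 1 else 0
  | 0, b + 1, i, ε => ∑ j ∈ range (i + 1), (i.choose j : ℚ) * lvYK k N r i j ε * innerK k N r odd 0 b j ε
  | m + 1, b, i, ε => ∑ j ∈ range (i + 1), lvXK k N i j ε * innerK k N r odd m b j ε

/-- The normalised top double sum `Σ_{i≤N} Σ_{j≤i} (−1)^j C(i,j) C(n,k+j) topBK(i,j) R(0,k+j+1;−ε)(−ε) R(0,N−j+1;ε)ε · inner(j)`.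
[cite: KrattenthalerRivoal2007, §13 (eq:briques)] -/
def gSumK (k N r M B : ℕ) (odd : Bool) (ε : ℚ) : ℚ :=
  ∑ i ∈ range (N + 1), ∑ j ∈ range (i + 1), (-1) ^ j * ((i.choose j * (k + N).choose (k + j) : ℕ) : ℚ) *
    topBK k N i j ε * rbMinus (k + j) ε * rbPlus (N - j) ε * innerK k N r odd M B j ε

/-- An `if`-constant is `IsDInt`. [folklore] -/
private theorem isDInt_ite' (d N' i : ℕ) (odd : Bool) :
    IsDInt d N' (fun _ : ℚ => if odd then (1 : ℚ) else if i = 0 then 1 else 0) 0 := by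
  split_ifs
  · exact IsDInt.one d N' 0
  · exact IsDInt.one d N' 0
  · exact (IsDInt.const d N' 0 0).congr (Eventually.of_forall fun _ => by simp)

/-- `innerK` is `IsDInt (d_n)` at `0` (`r ≥ 1`, `i ≤ N`). [cite: KrattenthalerRivoal2007, §13 proof of Prop. 7] -/
theorem innerK_isDInt {k N r : ℕ} (hr : 1 ≤ r) (odd : Bool) (N' : ℕ) :
    ∀ m b i, i ≤ N → IsDInt (Nat.lcmUpto (k + N)) N' (innerK k N r odd m b i) 0 := by
  intro m
  induction m with
  | zero =>
    intro b
    induction b with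
    | zero => intro i _; exact (isDInt_ite' _ N' i odd).congr (Eventually.of_forall fun ε => by simp [innerK])
    | succ b ih =>
      intro i hi
      have h : IsDInt (Nat.lcmUpto (k + N)) N'
          (fun ε => ∑ j ∈ range (i + 1), (i.choose j : ℚ) * lvYK k N r i j ε * innerK k N r odd 0 b j ε) 0 := by
        refine IsDInt.sum _ fun j hj => ?_
        have hji : j ≤ i := Nat.lt_succ_iff.mp (mem_range.mp hj)
        exact (((IsDInt.const _ N' (i.choose j : ℤ) 0).congr (Eventually.of_forall fun _ => by push_cast; rfl)).mul
          (lvYK_isDInt hr hji hi N')).mul (ih j (hji.trans hi))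
      exact h.congr (Eventually.of_forall fun ε => by simp [innerK])
  | succ m ih =>
    intro b i hi
    have h : IsDInt (Nat.lcmUpto (k + N)) N' (fun ε => ∑ j ∈ range (i + 1), lvXK k N i j ε * innerK k N r odd m b j ε) 0 := by
      refine IsDInt.sum _ fun j hj => ?_
      have hji : j ≤ i := Nat.lt_succ_iff.mp (mem_range.mp hj)
      exact (lvXK_isDInt hji hi N').mul (ih b j (hji.trans hi))
    exact h.congr (Eventually.of_forall fun ε => by simp [innerK])

/-- `gSumK` is `IsDInt (d_n)` at `0` (`k ≥ 1`, `r ≥ 1`). [cite: KrattenthalerRivoal2007, §13 proof of Prop. 7] -/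
theorem gSumK_isDInt {k N r : ℕ} (hk : 1 ≤ k) (hr : 1 ≤ r) (M B : ℕ) (odd : Bool) (N' : ℕ) :
    IsDInt (Nat.lcmUpto (k + N)) N' (gSumK k N r M B odd) 0 := by
  unfold gSumK
  refine IsDInt.sum _ fun i hi => IsDInt.sum _ fun j hj => ?_
  have hiN : i ≤ N := Nat.lt_succ_iff.mp (mem_range.mp hi)
  have hji : j ≤ i := Nat.lt_succ_iff.mp (mem_range.mp hj)
  have h := ((((IsDInt.const _ N' ((-1) ^ j * ((i.choose j * (k + N).choose (k + j) : ℕ) : ℤ)) 0).mul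
    (topBK_isDInt hk hji hiN N')).mul (rbMinus_isDInt (n := k + N) (i := k + j) (by omega) N')).mul
    (rbPlus_isDInt (n := k + N) (i := N - j) (by omega) N')).mul (innerK_isDInt hr odd N' M B j (hji.trans hiN))
  refine h.congr (Eventually.of_forall fun ε => ?_)
  push_cast
  ring

/-! ### The tail chain at `a = −N+k−2ε`: raw sub-chains, windows, numerators, gaps -/

/-- The sub-chain below the two top pairs: `m` pairs `(x',x')`, `b` pairs `(x',y')`, and — for odd `A` — the unpaired
`x'` innermost (`x' = −N−ε`, `y' = rn+k+1−ε`, `n = k+N`). [cite: KrattenthalerRivoal2007, §9 proofs of Corollaires 1–2] -/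
def chainK (k N r : ℕ) (odd : Bool) (m b : ℕ) (ε : ℚ) : List (ℚ × Option ℚ) :=
  List.replicate m (-(N : ℚ) - ε, some (-(N : ℚ) - ε)) ++
    (List.replicate b (-(N : ℚ) - ε, some (((r * (k + N) : ℕ) : ℚ) + (k : ℚ) + 1 - ε)) ++
      (if odd then [(-(N : ℚ) - ε, none)] else []))

/-- The raw inner factor of the sub-chain `chainK … m b` at outer index `i`.
[cite: KrattenthalerRivoal2007, §13 (eq:briques)] -/
def rawK (k N r : ℕ) (odd : Bool) (m b i : ℕ) (ε : ℚ) : ℚ :=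
  linkTailCore (-(N : ℚ) + k - 2 * ε) (chainK k N r odd m b ε) N i

/-- The `x'`-window `(1+a−x'+i)_{N−i} = (1+k+i−ε)_{N−i}`. [cite: KrattenthalerRivoal2007, §13 (eq:briques)] -/
def xWinK (k N i : ℕ) (ε : ℚ) : ℚ := ∏ l ∈ range (N - i), (1 + (k : ℚ) - ε + i + l)

/-- The `y'`-window `(1+a−y'+i)_{N−i} = (−N−rn−ε+i)_{N−i}`. [cite: KrattenthalerRivoal2007, §13 (eq:briques)] -/
def yWinK (k N r i : ℕ) (ε : ℚ) : ℚ := ∏ l ∈ range (N - i), (-(N : ℚ) - ((r * (k + N) : ℕ) : ℚ) - ε + i + l)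

/-- The numerator `(x')_j = (−N−ε)_j`. [cite: KrattenthalerRivoal2007, §13 (eq:briques)] -/
def xNumK (N j : ℕ) (ε : ℚ) : ℚ := ∏ l ∈ range j, (-(N : ℚ) - ε + l)

/-- The numerator `(y')_j = (rn+k+1−ε)_j`. [cite: KrattenthalerRivoal2007, §13 (eq:briques)] -/
def yNumK (k N r j : ℕ) (ε : ℚ) : ℚ := ∏ l ∈ range j, (((r * (k + N) : ℕ) : ℚ) + k + 1 - ε + l)

/-- The numerator `(c₂)_j = (1+k−2ε)_j`. [cite: KrattenthalerRivoal2007, §13 (eq:briques)] -/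
def cNumK (k j : ℕ) (ε : ℚ) : ℚ := ∏ l ∈ range j, (1 + (k : ℚ) - 2 * ε + l)

/-- The gap `(1+a−x'−y')_{i−j} = (−rn)_{i−j}`. [cite: KrattenthalerRivoal2007, §13 (eq:briques)] -/
def yGapK (k N r i j : ℕ) : ℚ := ∏ l ∈ range (i - j), (-((r * (k + N) : ℕ) : ℚ) + l)

/-- The gap `(1+a−2x')_{i−j} = (n+1)_{i−j}`. [cite: KrattenthalerRivoal2007, §13 (eq:briques)] -/
def xGapK (k N i j : ℕ) : ℚ := ∏ l ∈ range (i - j), (((k + N : ℕ) : ℚ) + 1 + l)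

/-- The gap `(1+a−x'−c₂)_{i−j} = (ε)_{i−j}`. [cite: KrattenthalerRivoal2007, §13 (eq:briques) (the factor (ε)_{i_m−i_{m−1}})] -/
def cGapK (i j : ℕ) (ε : ℚ) : ℚ := ∏ l ∈ range (i - j), (ε + l)

/-- The top gap `(1+a−x'−1)_{N−i} = (k−ε)_{N−i}`. [cite: KrattenthalerRivoal2007, §13 (eq:briques)] -/
def tGapK (k N i : ℕ) (ε : ℚ) : ℚ := ∏ l ∈ range (N - i), ((k : ℚ) - ε + l)

/-- The `c₂`-window `(1+a−c₂+i)_{N−i} = (−N+i)_{N−i}`. [cite: KrattenthalerRivoal2007, §13 (eq:briques)] -/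
def cWinK (N i : ℕ) : ℚ := ∏ l ∈ range (N - i), (-(N : ℚ) + i + l)

/-! ### The recursions of the raw sub-chains -/

/-- Even base: `rawK … false 0 0 i = [i = 0]`. [cite: KrattenthalerRivoal2007, §13 (eq:briques)] -/
theorem rawK_base_even (k N r i : ℕ) (ε : ℚ) : rawK k N r false 0 0 i ε = if i = 0 then 1 else 0 := by
  unfold rawK chainK
  simp only [List.replicate_zero, List.nil_append, Bool.false_eq_true, ↓reduceIte]
  exact linkTailCore_nil _ N i

/-- Odd base: `rawK … true 0 0 i = xWinK(i)` (the unpaired `x'`). [cite: KrattenthalerRivoal2007, §9 proof of Corollaire 2] -/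
theorem rawK_base_odd (k N r i : ℕ) (ε : ℚ) : rawK k N r true 0 0 i ε = xWinK k N i ε := by
  unfold rawK chainK xWinK
  simp only [List.replicate_zero, List.nil_append, ↓reduceIte]
  rw [linkTailCore_single_none]
  exact prod_congr rfl fun l _ => by ring

/-- A `(x',y')`-step. [cite: KrattenthalerRivoal2007, §13 (eq:briques)] -/
theorem rawK_y_succ (k N r : ℕ) (odd : Bool) (b : ℕ) {i : ℕ} (hi : i ≤ N) (ε : ℚ) :
    rawK k N r odd 0 (b + 1) i ε = xWinK k N i ε * yWinK k N r i ε *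
      ∑ j ∈ range (i + 1), (i.choose j : ℚ) * yGapK k N r i j * xNumK N j ε * yNumK k N r j ε * rawK k N r odd 0 b j ε := by
  unfold rawK chainK
  rw [List.replicate_zero, List.nil_append, List.nil_append, List.replicate_succ, List.cons_append,
    linkTailCore_cons_some _ _ _ _ hi]
  unfold xWinK yWinK yGapK xNumK yNumK
  congr 1
  · congr 1
    · exact prod_congr rfl fun l _ => by ring
    · exact prod_congr rfl fun l _ => by ring
  · refine sum_congr rfl fun j _ => ?_
    congr 3
    congr 2
    funext l
    ring

/-- A `(x',x')`-step. [cite: KrattenthalerRivoal2007, §13 (eq:briques)] -/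
theorem rawK_x_succ (k N r : ℕ) (odd : Bool) (m b : ℕ) {i : ℕ} (hi : i ≤ N) (ε : ℚ) :
    rawK k N r odd (m + 1) b i ε = xWinK k N i ε * xWinK k N i ε *
      ∑ j ∈ range (i + 1), (i.choose j : ℚ) * xGapK k N i j * xNumK N j ε * xNumK N j ε * rawK k N r odd m b j ε := by
  unfold rawK chainK
  rw [List.replicate_succ, List.cons_append, linkTailCore_cons_some _ _ _ _ hi]
  unfold xWinK xGapK xNumK
  congr 1
  · congr 1
    · exact prod_congr rfl fun l _ => by ring
    · exact prod_congr rfl fun l _ => by ring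
  · refine sum_congr rfl fun j _ => ?_
    congr 3
    congr 2
    funext l
    push_cast
    ring

/-- The two top pairs: `linkReducedMultiSum a ((x',1)::(x',c₂)::chain) N =
Σ_i C(N,i) (k−ε)_{N−i} (x')_i i! · xWinK(i) cWinK(i) Σ_j C(i,j) (ε)_{i−j} (x')_j (c₂)_j · rawK M B j`.
[cite: KrattenthalerRivoal2007, §13 (eq:briques) (the top lines)] -/
theorem top_expand (k N r M B : ℕ) (odd : Bool) (ε : ℚ) :
    linkReducedMultiSum (-(N : ℚ) + k - 2 * ε)
        ((-(N : ℚ) - ε, some 1) :: (-(N : ℚ) - ε, some (1 + (k : ℚ) - 2 * ε)) :: chainK k N r odd M B ε) N =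
      ∑ i ∈ range (N + 1), (N.choose i : ℚ) * tGapK k N i ε * xNumK N i ε * (i ! : ℚ) *
        (xWinK k N i ε * cWinK N i * ∑ j ∈ range (i + 1), (i.choose j : ℚ) * cGapK i j ε * xNumK N j ε * cNumK k j ε *
          rawK k N r odd M B j ε) := by
  rw [linkReducedMultiSum_cons_some]
  refine sum_congr rfl fun i hi => ?_
  have hiN : i ≤ N := Nat.lt_succ_iff.mp (mem_range.mp hi)
  have hcore : linkTailProd (-(N : ℚ) + k - 2 * ε) ((-(N : ℚ) - ε, some (1 + (k : ℚ) - 2 * ε)) :: chainK k N r odd M B ε) i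
      (N - i) * linkReducedMultiSum (-(N : ℚ) + k - 2 * ε) ((-(N : ℚ) - ε, some (1 + (k : ℚ) - 2 * ε)) :: chainK k N r odd M B ε) i =
      xWinK k N i ε * cWinK N i * ∑ j ∈ range (i + 1), (i.choose j : ℚ) * cGapK i j ε * xNumK N j ε * cNumK k j ε *
        rawK k N r odd M B j ε := by
    have h := linkTailCore_cons_some (-(N : ℚ) + k - 2 * ε) (-(N : ℚ) - ε) (1 + (k : ℚ) - 2 * ε) (chainK k N r odd M B ε) hiN
    unfold linkTailCore at h
    rw [h]
    unfold xWinK cWinK cGapK xNumK cNumK rawK linkTailCore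
    congr 1
    · congr 1
      · exact prod_congr rfl fun l _ => by ring
      · exact prod_congr rfl fun l _ => by ring
    · refine sum_congr rfl fun j _ => ?_
      congr 3
      congr 2
      funext l
      ring
  have e1 : ∏ l ∈ range (N - i), (1 + (-(N : ℚ) + k - 2 * ε) - (-(N : ℚ) - ε) - 1 + (l : ℚ)) = tGapK k N i ε :=
    prod_congr rfl fun l _ => by ring
  have e2 : ∏ l ∈ range i, ((1 : ℚ) + (l : ℚ)) = (i ! : ℚ) := by
    rw [← pw_def, pw_one]
  rw [mul_assoc ((N.choose i : ℚ) * _ * _ * _) , hcore, e1, e2]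
  unfold xNumK
  ring

/-! ### Window identities -/

/-- `(a+1)_m · a! = (a+m)!`. [folklore] -/
private theorem pw_nat_succ_mul_factorial (a m : ℕ) : pw ((a : ℚ) + 1) m * (a ! : ℚ) = ((a + m)! : ℚ) := by
  induction m with
  | zero => simp [pw]
  | succ m ih =>
    rw [pw_succ, mul_right_comm, ih, ← Nat.add_assoc, Nat.factorial_succ (a + m)]
    push_cast
    ring

/-- Nonvanishing of `(K ∓ ε)`-type factors for `|ε| < 1/2`, `K ≥ 1`. [folklore] -/
private theorem pw_shift_ne_zero {ε : ℚ} (h1 : ε < 1 / 2) (h2 : -(1 / 2) < ε) {z : ℚ} (hz : 1 ≤ z) (m : ℕ) :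
    pw (z - ε) m ≠ 0 ∧ pw (z + ε) m ≠ 0 ∧ pw (z - 2 * ε) m ≠ 0 := by
  refine ⟨prod_ne_zero_iff.2 fun l _ => ?_, prod_ne_zero_iff.2 fun l _ => ?_, prod_ne_zero_iff.2 fun l _ => ?_⟩ <;>
  · have : (0 : ℚ) ≤ l := Nat.cast_nonneg l
    intro h
    linarith

/-- `xWinK(i) · (1−ε)_{k+i} = (1−ε)_n`. [folklore] -/
private theorem xWinK_mul {k N i : ℕ} (hi : i ≤ N) (ε : ℚ) :
    xWinK k N i ε * pw (1 - ε) (k + i) = pw (1 - ε) (k + N) := by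
  have h : pw (1 - ε) (k + N) = pw (1 - ε) (k + i) * pw (1 - ε + ((k + i : ℕ) : ℚ)) (N - i) := by
    rw [← pw_add]; congr 1; omega
  rw [h]
  unfold xWinK
  rw [← pw_def, pw_congr (show 1 + (k : ℚ) - ε + i = 1 - ε + ((k + i : ℕ) : ℚ) by push_cast; ring)]
  ring

/-- `(x')_j · (1+ε)_{N−j} = (−1)^j (1+ε)_N`. [folklore] -/
private theorem xNumK_mul {N j : ℕ} (hj : j ≤ N) (ε : ℚ) :
    xNumK N j ε * pw (1 + ε) (N - j) = (-1) ^ j * pw (1 + ε) N := by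
  unfold xNumK
  rw [← pw_def, pw_congr (show -(N : ℚ) - ε = -((N : ℚ) + ε) by ring), pw_neg_rev]
  have h : pw (1 + ε) N = pw (1 + ε) (N - j) * pw (1 + ε + ((N - j : ℕ) : ℚ)) j := by
    rw [← pw_add, Nat.sub_add_cancel hj]
  rw [h, pw_congr (show (N : ℚ) + ε - j + 1 = 1 + ε + ((N - j : ℕ) : ℚ) by rw [Nat.cast_sub hj]; ring)]
  ring

/-- `(1+ε)_N · (1+ε+N)_k = (1+ε)_n`. [folklore] -/
private theorem dplus_mul_P (k N : ℕ) (ε : ℚ) :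
    pw (1 + ε) N * ∏ i ∈ range k, (1 + ε + (N : ℚ) + i) = pw (1 + ε) (k + N) := by
  rw [Nat.add_comm, pw_add, ← pw_def]

/-- `yWinK(i) = (−1)^{N−i} (rn+1+ε)_{N−i}`. [folklore] -/
private theorem yWinK_eq (k N r : ℕ) {i : ℕ} (hi : i ≤ N) (ε : ℚ) :
    yWinK k N r i ε = (-1) ^ (N - i) * pw (((r * (k + N) : ℕ) : ℚ) + 1 + ε) (N - i) := by
  unfold yWinK
  rw [← pw_def, pw_congr (show -(N : ℚ) - ((r * (k + N) : ℕ) : ℚ) - ε + i =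
    -(((r * (k + N) : ℕ) : ℚ) + ((N - i : ℕ) : ℚ) + ε) by rw [Nat.cast_sub hi]; ring), pw_neg_rev]
  congr 1
  exact pw_congr (by ring) _

/-- `yGapK(i,j) · (rn−(i−j))! = (−1)^{i−j} (rn)!` (`i−j ≤ rn`). [folklore] -/
private theorem yGapK_mul {k N r i j : ℕ} (h : i - j ≤ r * (k + N)) :
    yGapK k N r i j * (((r * (k + N) - (i - j))! : ℕ) : ℚ) = (-1) ^ (i - j) * (((r * (k + N))! : ℕ) : ℚ) := by
  unfold yGapK
  rw [← pw_def, pw_neg_rev, pw_congr (show (((r * (k + N) : ℕ) : ℚ)) - ((i - j : ℕ) : ℚ) + 1 =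
    ((r * (k + N) - (i - j) : ℕ) : ℚ) + 1 by rw [Nat.cast_sub h]), mul_assoc, pw_nat_succ_mul_factorial,
    Nat.sub_add_cancel h]

/-- `xGapK(i,j) · n! = (n+i−j)!`. [folklore] -/
private theorem xGapK_mul (k N i j : ℕ) :
    xGapK k N i j * ((k + N)! : ℚ) = ((k + N + (i - j))! : ℚ) := by
  unfold xGapK
  rw [← pw_def]
  exact_mod_cast pw_nat_succ_mul_factorial (k + N) (i - j)

/-- `cWinK(i) = (−1)^{N−i} (N−i)!`. [folklore] -/
private theorem cWinK_eq {N i : ℕ} (hi : i ≤ N) : cWinK N i = (-1) ^ (N - i) * ((N - i)! : ℚ) := by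
  unfold cWinK
  rw [← pw_def, pw_congr (show -(N : ℚ) + i = -((N - i : ℕ) : ℚ) by rw [Nat.cast_sub hi]; ring), pw_neg_nat]

/-- `R₁`'s window in Pochhammer form: `R₁(n,N−i,n−i+j;ε) · n!^r · (rn−(i−j))! = (rn)! · (N−j+1+ε)_{rn−(i−j)}`
(`r ≥ 1`, `j ≤ i ≤ N`). [cite: KrattenthalerRivoal2007, §11 Lemme 10 (definition of R₁)] -/
private theorem specialBrickR1_window {k N r i j : ℕ} (hr : 1 ≤ r) (hji : j ≤ i) (hi : i ≤ N) (ε : ℚ) :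
    specialBrickR1 (k + N) r (N - i) (k + N - i + j) ε * ((k + N)! : ℚ) ^ r * (((r * (k + N) - (i - j))! : ℕ) : ℚ) =
      (((r * (k + N))! : ℕ) : ℚ) * pw (((N - j : ℕ) : ℚ) + 1 + ε) (r * (k + N) - (i - j)) := by
  have hrn : k + N ≤ r * (k + N) := Nat.le_mul_of_pos_left _ hr
  have hsub : (r - 1) * (k + N) + (k + N - i + j) = r * (k + N) - (i - j) := by
    rw [Nat.sub_one_mul]; omega
  have hIoc : ∏ f ∈ Ioc (k + N + (N - i) - (k + N - i + j)) (r * (k + N) + (N - i)), ((f : ℚ) + ε) =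
      pw (((N - j : ℕ) : ℚ) + 1 + ε) (r * (k + N) - (i - j)) := by
    rw [show k + N + (N - i) - (k + N - i + j) = N - j by omega,
      show r * (k + N) + (N - i) = (N - j) + (r * (k + N) - (i - j)) by omega, prod_Ioc_add_eq_pw]
  unfold specialBrickR1
  rw [hsub, hIoc]
  have h1 : ((k + N)! : ℚ) ^ r ≠ 0 := by positivity
  have h2 : (((r * (k + N) - (i - j))! : ℕ) : ℚ) ≠ 0 := by positivity
  field_simp

/-- `tGapK(i) · (1−ε)_{k−1} · (n−i−ε)_{i+1} = (1−ε)_n` (`k ≥ 1`, `i ≤ N`). [folklore] -/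
private theorem tGapK_mul {k N i : ℕ} (hk : 1 ≤ k) (hi : i ≤ N) (ε : ℚ) :
    pw (1 - ε) (k - 1) * tGapK k N i ε * pw (((k + N - i : ℕ) : ℚ) - ε) (i + 1) = pw (1 - ε) (k + N) := by
  have e1 : ((k - 1 : ℕ) : ℚ) + 1 = (k : ℚ) := by norm_cast; omega
  have e2 : (((k - 1) + (N - i) : ℕ) : ℚ) + 1 = ((k + N - i : ℕ) : ℚ) := by norm_cast; omega
  have h : pw (1 - ε) (k + N) = pw (1 - ε) (k - 1) * pw ((k : ℚ) - ε) (N - i) * pw (((k + N - i : ℕ) : ℚ) - ε) (i + 1) := by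
    conv_lhs => rw [show k + N = ((k - 1) + (N - i)) + (i + 1) by omega]
    rw [pw_add, pw_add, pw_congr (show 1 - ε + ((k - 1 : ℕ) : ℚ) = (k : ℚ) - ε by linear_combination e1) (N - i),
      pw_congr (show 1 - ε + (((k - 1) + (N - i) : ℕ) : ℚ) = ((k + N - i : ℕ) : ℚ) - ε by linear_combination e2) (i + 1)]
  rw [h]
  unfold tGapK
  rw [← pw_def]

/-! ### The level identities: raw level × normaliser = integer × bricks -/

/-- **The `(x',y')`-level identity** (`r ≥ 1`, `j ≤ i ≤ N`):
`yWin(i)·(−rn)_{i−j}·(x')_j·(y')_j·xWin(j) · (1−ε)_{rn}(rn+1−ε)_k · (1+ε)_{rn}(1+ε+N)_k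
 = (−1)^N (1+ε)_n (1−ε)_n n!^{2r} · lvYK(i,j)`. [cite: KrattenthalerRivoal2007, §13 (eq:briques), second line] -/
theorem yUnitK_eq {k N r i j : ℕ} (hr : 1 ≤ r) (hji : j ≤ i) (hi : i ≤ N) (ε : ℚ) :
    yWinK k N r i ε * yGapK k N r i j * xNumK N j ε * yNumK k N r j ε * xWinK k N j ε *
        ((∏ l ∈ range (r * (k + N)), (1 - ε + (l : ℚ))) * ∏ i' ∈ range k, (((r * (k + N) : ℕ) : ℚ) + 1 - ε + i')) *
        ((∏ l ∈ range (r * (k + N)), (1 + ε + (l : ℚ))) * ∏ i' ∈ range k, (1 + ε + (N : ℚ) + i')) =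
      (-1) ^ N * (∏ l ∈ range (k + N), (1 + ε + (l : ℚ))) * (∏ l ∈ range (k + N), (1 - ε + (l : ℚ))) *
        ((k + N)! : ℚ) ^ (2 * r) * lvYK k N r i j ε := by
  have hrn : k + N ≤ r * (k + N) := Nat.le_mul_of_pos_left _ hr
  have hF : i - j ≤ r * (k + N) := by omega
  -- the atoms
  set A := pw (1 - ε) (k + j) with hA
  set Wm := pw (((k + j + 1 : ℕ) : ℚ) - ε) (r * (k + N)) with hWm
  set V := pw (((r * (k + N) : ℕ) : ℚ) + 1 + ε) (N - i) with hV
  set Wp := pw (((N - j : ℕ) : ℚ) + 1 + ε) (r * (k + N) - (i - j)) with hWp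
  set Dplus := pw (1 + ε) N with hDplus
  set Ff := (((r * (k + N) - (i - j))! : ℕ) : ℚ) with hFf
  set RN := (((r * (k + N))! : ℕ) : ℚ) with hRN
  have hFf0 : Ff ≠ 0 := by positivity
  -- minus side
  have c1 : (∏ l ∈ range (r * (k + N)), (1 - ε + (l : ℚ))) * (∏ i' ∈ range k, (((r * (k + N) : ℕ) : ℚ) + 1 - ε + i')) *
      yNumK k N r j ε = A * Wm := by
    have L : pw (1 - ε) (r * (k + N) + k + j) = (∏ l ∈ range (r * (k + N)), (1 - ε + (l : ℚ))) *
        (∏ i' ∈ range k, (((r * (k + N) : ℕ) : ℚ) + 1 - ε + i')) * yNumK k N r j ε := by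
      unfold yNumK
      rw [pw_add, pw_add, ← pw_def, ← pw_def, ← pw_def,
        pw_congr (show (1 : ℚ) - ε + ((r * (k + N) : ℕ) : ℚ) = ((r * (k + N) : ℕ) : ℚ) + 1 - ε by ring) k,
        pw_congr (show (1 : ℚ) - ε + ((r * (k + N) + k : ℕ) : ℚ) = ((r * (k + N) : ℕ) : ℚ) + (k : ℚ) + 1 - ε by
          push_cast; ring) j]
    have R : pw (1 - ε) (r * (k + N) + k + j) = A * Wm := by
      rw [show r * (k + N) + k + j = (k + j) + r * (k + N) by omega, pw_add, hA, hWm,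
        pw_congr (show (1 : ℚ) - ε + ((k + j : ℕ) : ℚ) = ((k + j + 1 : ℕ) : ℚ) - ε by push_cast; ring) (r * (k + N))]
    rw [← L, R]
  have c2 : xWinK k N j ε * A = ∏ l ∈ range (k + N), (1 - ε + (l : ℚ)) := by
    rw [hA, xWinK_mul (hji.trans hi), pw_def]
  have c3 : pbBlockMinus (k + N) r (k + j + 1) ε * ((k + N)! : ℚ) ^ r = Wm := by
    rw [hWm, pbBlockMinus_mul']
  -- plus side
  have c4 : yWinK k N r i ε = (-1) ^ (N - i) * V := yWinK_eq k N r hi ε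
  have c5 : (∏ l ∈ range (r * (k + N)), (1 + ε + (l : ℚ))) * V = pw (1 + ε) (N - j) * Wp := by
    have L : pw (1 + ε) (r * (k + N) + (N - i)) = (∏ l ∈ range (r * (k + N)), (1 + ε + (l : ℚ))) * V := by
      rw [pw_add, ← pw_def, hV,
        pw_congr (show (1 : ℚ) + ε + ((r * (k + N) : ℕ) : ℚ) = ((r * (k + N) : ℕ) : ℚ) + 1 + ε by ring) (N - i)]
    have R : pw (1 + ε) (r * (k + N) + (N - i)) = pw (1 + ε) (N - j) * Wp := by
      rw [show r * (k + N) + (N - i) = (N - j) + (r * (k + N) - (i - j)) by omega, pw_add, hWp,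
        pw_congr (show (1 : ℚ) + ε + ((N - j : ℕ) : ℚ) = ((N - j : ℕ) : ℚ) + 1 + ε by ring) (r * (k + N) - (i - j))]
    rw [← L, R]
  have c6 : xNumK N j ε * pw (1 + ε) (N - j) = (-1) ^ j * Dplus := xNumK_mul (hji.trans hi) ε
  have c7 : Dplus * (∏ i' ∈ range k, (1 + ε + (N : ℚ) + i')) = ∏ l ∈ range (k + N), (1 + ε + (l : ℚ)) := by
    rw [hDplus, dplus_mul_P, pw_def]
  have c8 : specialBrickR1 (k + N) r (N - i) (k + N - i + j) ε * ((k + N)! : ℚ) ^ r * Ff = RN * Wp :=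
    specialBrickR1_window hr hji hi ε
  have c9 : yGapK k N r i j * Ff = (-1) ^ (i - j) * RN := yGapK_mul hF
  have hs : (-1 : ℚ) ^ (N - i) * (-1) ^ j * (-1) ^ (i - j) = (-1) ^ N := by
    rw [← pow_add, ← pow_add]
    congr 1
    omega
  -- assemble
  apply mul_right_cancel₀ hFf0
  unfold lvYK
  rw [c4, ← c7, ← c2]
  set Xw := xWinK k N j ε
  set Xn := xNumK N j ε
  set Yn := yNumK k N r j ε
  set G := yGapK k N r i j
  set Rm := ∏ l ∈ range (r * (k + N)), (1 - ε + (l : ℚ))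
  set Q := ∏ i' ∈ range k, (((r * (k + N) : ℕ) : ℚ) + 1 - ε + i')
  set Rp := ∏ l ∈ range (r * (k + N)), (1 + ε + (l : ℚ))
  set P := ∏ i' ∈ range k, (1 + ε + (N : ℚ) + i')
  set nf := ((k + N)! : ℚ)
  set pb := pbBlockMinus (k + N) r (k + j + 1) ε
  set R1 := specialBrickR1 (k + N) r (N - i) (k + N - i + j) ε
  set PN := pw (1 + ε) (N - j)
  calc (-1) ^ (N - i) * V * G * Xn * Yn * Xw * (Rm * Q) * (Rp * P) * Ff
      = (-1) ^ (N - i) * (G * Ff) * Xn * (Rm * Q * Yn) * Xw * (Rp * V) * P := by ring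
    _ = (-1) ^ (N - i) * ((-1) ^ (i - j) * RN) * Xn * (A * Wm) * Xw * (PN * Wp) * P := by rw [c9, c1, c5]
    _ = (-1) ^ (N - i) * (-1) ^ (i - j) * RN * (Xn * PN) * Wp * A * Wm * Xw * P := by ring
    _ = (-1) ^ (N - i) * (-1) ^ (i - j) * RN * ((-1) ^ j * Dplus) * Wp * A * Wm * Xw * P := by rw [c6]
    _ = ((-1) ^ (N - i) * (-1) ^ j * (-1) ^ (i - j)) * Dplus * P * (Xw * A) * Wm * (RN * Wp) := by ring
    _ = (-1) ^ N * Dplus * P * (Xw * A) * (pb * nf ^ r) * (R1 * nf ^ r * Ff) := by rw [hs, c3, c8]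
    _ = (-1) ^ N * (Dplus * P) * (Xw * A) * nf ^ (2 * r) * (pb * R1) * Ff := by ring

/-- **The even base `(x',y')`-level** (`i_0 = 0`, no window below; `r ≥ 1`, `i ≤ N`):
`yWin(i)·(−rn)_i · (1−ε)_{rn}(rn+1−ε)_k·(1+ε)_{rn}(1+ε+N)_k = (−1)^N (1+ε)_n n!^{2r} · k!·R(k,0;1−ε) · lvYK(i,0)`.
[cite: KrattenthalerRivoal2007, §13 (eq:briques), level j = 1] -/
theorem yUnitK0_eq {k N r i : ℕ} (hr : 1 ≤ r) (hi : i ≤ N) (ε : ℚ) :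
    yWinK k N r i ε * yGapK k N r i 0 *
        ((∏ l ∈ range (r * (k + N)), (1 - ε + (l : ℚ))) * ∏ i' ∈ range k, (((r * (k + N) : ℕ) : ℚ) + 1 - ε + i')) *
        ((∏ l ∈ range (r * (k + N)), (1 + ε + (l : ℚ))) * ∏ i' ∈ range k, (1 + ε + (N : ℚ) + i')) =
      (-1) ^ N * (∏ l ∈ range (k + N), (1 + ε + (l : ℚ))) * ((k + N)! : ℚ) ^ (2 * r) *
        ((k ! : ℚ) * polyBrick 1 k (-ε)) * lvYK k N r i 0 ε := by
  have hrn : k + N ≤ r * (k + N) := Nat.le_mul_of_pos_left _ hr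
  have hF : i - 0 ≤ r * (k + N) := by omega
  set Wm := pw (((k + 0 + 1 : ℕ) : ℚ) - ε) (r * (k + N)) with hWm
  set V := pw (((r * (k + N) : ℕ) : ℚ) + 1 + ε) (N - i) with hV
  set Wp := pw (((N - 0 : ℕ) : ℚ) + 1 + ε) (r * (k + N) - (i - 0)) with hWp
  set Dplus := pw (1 + ε) N with hDplus
  set Ff := (((r * (k + N) - (i - 0))! : ℕ) : ℚ) with hFf
  set RN := (((r * (k + N))! : ℕ) : ℚ) with hRN
  have hFf0 : Ff ≠ 0 := by positivity
  have c1 : (∏ l ∈ range (r * (k + N)), (1 - ε + (l : ℚ))) * (∏ i' ∈ range k, (((r * (k + N) : ℕ) : ℚ) + 1 - ε + i')) =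
      ((k ! : ℚ) * polyBrick 1 k (-ε)) * Wm := by
    have L : pw (1 - ε) (r * (k + N) + k) = (∏ l ∈ range (r * (k + N)), (1 - ε + (l : ℚ))) *
        (∏ i' ∈ range k, (((r * (k + N) : ℕ) : ℚ) + 1 - ε + i')) := by
      rw [pw_add, ← pw_def, ← pw_def,
        pw_congr (show (1 : ℚ) - ε + ((r * (k + N) : ℕ) : ℚ) = ((r * (k + N) : ℕ) : ℚ) + 1 - ε by ring) k]
    have hk0 : (k ! : ℚ) ≠ 0 := by positivity
    have R : pw (1 - ε) (r * (k + N) + k) = ((k ! : ℚ) * polyBrick 1 k (-ε)) * Wm := by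
      rw [Nat.add_comm, pw_add, hWm, mul_comm (k ! : ℚ)]
      unfold polyBrick
      rw [div_mul_cancel₀ _ hk0, ← pw_def, pw_congr (show -ε + ((1 : ℤ) : ℚ) = 1 - ε by push_cast; ring) k,
        pw_congr (show (1 : ℚ) - ε + (k : ℚ) = ((k + 0 + 1 : ℕ) : ℚ) - ε by push_cast; ring) (r * (k + N))]
    rw [← L, R]
  have c3 : pbBlockMinus (k + N) r (k + 0 + 1) ε * ((k + N)! : ℚ) ^ r = Wm := by
    rw [hWm, pbBlockMinus_mul']
  have c4 : yWinK k N r i ε = (-1) ^ (N - i) * V := yWinK_eq k N r hi ε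
  have c5 : (∏ l ∈ range (r * (k + N)), (1 + ε + (l : ℚ))) * V = Dplus * Wp := by
    have L : pw (1 + ε) (r * (k + N) + (N - i)) = (∏ l ∈ range (r * (k + N)), (1 + ε + (l : ℚ))) * V := by
      rw [pw_add, ← pw_def, hV,
        pw_congr (show (1 : ℚ) + ε + ((r * (k + N) : ℕ) : ℚ) = ((r * (k + N) : ℕ) : ℚ) + 1 + ε by ring) (N - i)]
    have R : pw (1 + ε) (r * (k + N) + (N - i)) = Dplus * Wp := by
      rw [show r * (k + N) + (N - i) = N + (r * (k + N) - (i - 0)) by omega, pw_add, hWp, hDplus]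
      simp only [Nat.sub_zero]
      exact congrArg _ (pw_congr (by ring) _)
    rw [← L, R]
  have c7 : Dplus * (∏ i' ∈ range k, (1 + ε + (N : ℚ) + i')) = ∏ l ∈ range (k + N), (1 + ε + (l : ℚ)) := by
    rw [hDplus, dplus_mul_P, pw_def]
  have c8 : specialBrickR1 (k + N) r (N - i) (k + N - i + 0) ε * ((k + N)! : ℚ) ^ r * Ff = RN * Wp :=
    specialBrickR1_window hr (Nat.zero_le i) hi ε
  have c9 : yGapK k N r i 0 * Ff = (-1) ^ (i - 0) * RN := yGapK_mul hF
  have hs : (-1 : ℚ) ^ (N - i) * (-1) ^ (i - 0) = (-1) ^ N := by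
    rw [← pow_add]
    congr 1
    omega
  apply mul_right_cancel₀ hFf0
  unfold lvYK
  rw [c4, ← c7]
  set G := yGapK k N r i 0
  set Rm := ∏ l ∈ range (r * (k + N)), (1 - ε + (l : ℚ))
  set Q := ∏ i' ∈ range k, (((r * (k + N) : ℕ) : ℚ) + 1 - ε + i')
  set Rp := ∏ l ∈ range (r * (k + N)), (1 + ε + (l : ℚ))
  set P := ∏ i' ∈ range k, (1 + ε + (N : ℚ) + i')
  set nf := ((k + N)! : ℚ)
  set pb := pbBlockMinus (k + N) r (k + 0 + 1) ε
  set R1 := specialBrickR1 (k + N) r (N - i) (k + N - i + 0) ε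
  set E0 := (k ! : ℚ) * polyBrick 1 k (-ε)
  calc (-1) ^ (N - i) * V * G * (Rm * Q) * (Rp * P) * Ff
      = (-1) ^ (N - i) * (G * Ff) * (Rm * Q) * (Rp * V) * P := by ring
    _ = (-1) ^ (N - i) * ((-1) ^ (i - 0) * RN) * (E0 * Wm) * (Dplus * Wp) * P := by rw [c9, c1, c5]
    _ = ((-1) ^ (N - i) * (-1) ^ (i - 0)) * Dplus * P * E0 * Wm * (RN * Wp) := by ring
    _ = (-1) ^ N * Dplus * P * E0 * (pb * nf ^ r) * (R1 * nf ^ r * Ff) := by rw [hs, c3, c8]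
    _ = (-1) ^ N * (Dplus * P) * nf ^ (2 * r) * E0 * (pb * R1) * Ff := by ring

/-- **The `(x',x')`-level identity** (`j ≤ i ≤ N`):
`C(i,j)·xWin(i)·(n+1)_{i−j}·(x')_j²·xWin(j)·n!²·((1+ε+N)_k)² = (1−ε)_n² (1+ε)_n² · lvXK(i,j)`.
[cite: KrattenthalerRivoal2007, §13 (eq:briques), fourth and fifth lines] -/
theorem xUnitK_eq {k N i j : ℕ} (hji : j ≤ i) (hi : i ≤ N) {ε : ℚ} (h1 : ε < 1 / 2) (h2 : -(1 / 2) < ε) :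
    (i.choose j : ℚ) * xWinK k N i ε * xGapK k N i j * xNumK N j ε * xNumK N j ε * xWinK k N j ε *
        ((k + N)! : ℚ) ^ 2 * (∏ i' ∈ range k, (1 + ε + (N : ℚ) + i')) ^ 2 =
      (∏ l ∈ range (k + N), (1 - ε + (l : ℚ))) ^ 2 * (∏ l ∈ range (k + N), (1 + ε + (l : ℚ))) ^ 2 * lvXK k N i j ε := by
  obtain ⟨hAi, -, -⟩ := pw_shift_ne_zero h1 h2 (le_refl (1 : ℚ)) (k + i)
  obtain ⟨hAj, -, -⟩ := pw_shift_ne_zero h1 h2 (le_refl (1 : ℚ)) (k + j)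
  obtain ⟨-, hPj, -⟩ := pw_shift_ne_zero h1 h2 (le_refl (1 : ℚ)) (N - j)
  set Ai := pw (1 - ε) (k + i) with hAi'
  set Aj := pw (1 - ε) (k + j) with hAj'
  set Pj := pw (1 + ε) (N - j) with hPj'
  set Dplus := pw (1 + ε) N with hDplus
  have c2i : xWinK k N i ε * Ai = ∏ l ∈ range (k + N), (1 - ε + (l : ℚ)) := by rw [hAi', xWinK_mul hi, pw_def]
  have c2j : xWinK k N j ε * Aj = ∏ l ∈ range (k + N), (1 - ε + (l : ℚ)) := by
    rw [hAj', xWinK_mul (hji.trans hi), pw_def]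
  have c6 : xNumK N j ε * Pj = (-1) ^ j * Dplus := xNumK_mul (hji.trans hi) ε
  have c7 : Dplus * (∏ i' ∈ range k, (1 + ε + (N : ℚ) + i')) = ∏ l ∈ range (k + N), (1 + ε + (l : ℚ)) := by
    rw [hDplus, dplus_mul_P, pw_def]
  have cg : xGapK k N i j * ((k + N)! : ℚ) = ((k + N + (i - j))! : ℚ) := xGapK_mul k N i j
  -- the bricks times their denominators
  have bi : rbMinus (k + i) ε * Ai = ((k + i)! : ℚ) := by
    unfold rbMinus; rw [hAi', pw_def, div_mul_cancel₀ _ (by rwa [← pw_def])]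
  have bj : rbMinus (k + j) ε * Aj = ((k + j)! : ℚ) := by
    unfold rbMinus; rw [hAj', pw_def, div_mul_cancel₀ _ (by rwa [← pw_def])]
  have bp : rbPlus (N - j) ε * Pj = ((N - j)! : ℚ) := by
    unfold rbPlus; rw [hPj', pw_def, div_mul_cancel₀ _ (by rwa [← pw_def])]
  -- the integer
  have hint : ((i.choose j * ((k + N + i - j).choose (k + i)) * ((k + N).choose (k + j)) : ℕ) : ℚ) *
      (((k + i)! : ℚ) * ((N - j)! : ℚ)) * (((k + j)! : ℚ) * ((N - j)! : ℚ)) =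
      (i.choose j : ℚ) * ((k + N + (i - j))! : ℚ) * ((k + N)! : ℚ) := by
    have e1 : ((k + N + i - j).choose (k + i)) * (k + i)! * (N - j)! = (k + N + (i - j))! := by
      rw [show k + N + (i - j) = k + N + i - j by omega, show N - j = k + N + i - j - (k + i) by omega]
      exact Nat.choose_mul_factorial_mul_factorial (by omega)
    have e2 : ((k + N).choose (k + j)) * (k + j)! * (N - j)! = (k + N)! := by
      rw [show N - j = k + N - (k + j) by omega]
      exact Nat.choose_mul_factorial_mul_factorial (by omega)
    have e1' : (((k + N + i - j).choose (k + i) : ℕ) : ℚ) * ((k + i)! : ℚ) * ((N - j)! : ℚ) = ((k + N + (i - j))! : ℚ) := by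
      exact_mod_cast e1
    have e2' : (((k + N).choose (k + j) : ℕ) : ℚ) * ((k + j)! : ℚ) * ((N - j)! : ℚ) = ((k + N)! : ℚ) := by
      exact_mod_cast e2
    push_cast
    linear_combination (i.choose j : ℚ) * (((k + N).choose (k + j) : ℕ) : ℚ) * ((k + j)! : ℚ) * ((N - j)! : ℚ) * e1' +
      (i.choose j : ℚ) * ((k + N + (i - j))! : ℚ) * e2'
  -- assemble: multiply both sides by Ai Aj Pj²
  have hden : Ai * Aj * Pj ^ 2 ≠ 0 := by positivity
  apply mul_right_cancel₀ hden
  rw [← c7, ← cg] at *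
  unfold lvXK
  set Xwi := xWinK k N i ε
  set Xwj := xWinK k N j ε
  set Xn := xNumK N j ε
  set G := xGapK k N i j
  set P := ∏ i' ∈ range k, (1 + ε + (N : ℚ) + i')
  set Dm := ∏ l ∈ range (k + N), (1 - ε + (l : ℚ))
  set nf := ((k + N)! : ℚ)
  set CC := (((i.choose j * ((k + N + i - j).choose (k + i)) * ((k + N).choose (k + j)) : ℕ) : ℚ))
  set rbi := rbMinus (k + i) ε
  set rbj := rbMinus (k + j) ε
  set rbp := rbPlus (N - j) ε
  calc (i.choose j : ℚ) * Xwi * G * Xn * Xn * Xwj * nf ^ 2 * P ^ 2 * (Ai * Aj * Pj ^ 2)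
      = (i.choose j : ℚ) * (G * nf) * nf * (Xwi * Ai) * (Xwj * Aj) * (Xn * Pj) ^ 2 * P ^ 2 := by ring
    _ = (i.choose j : ℚ) * (G * nf) * nf * Dm * Dm * ((-1) ^ j * Dplus) ^ 2 * P ^ 2 := by rw [c2i, c2j, c6]
    _ = ((i.choose j : ℚ) * (G * nf) * nf) * Dm ^ 2 * (Dplus * P) ^ 2 * ((-1) ^ j) ^ 2 := by ring
    _ = (CC * (rbi * Ai * (rbp * Pj)) * (rbj * Aj * (rbp * Pj))) * Dm ^ 2 * (Dplus * P) ^ 2 * 1 := by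
        rw [bi, bj, bp, hint, ← pow_mul, Even.neg_one_pow ⟨j, by ring⟩]
    _ = Dm ^ 2 * (Dplus * P) ^ 2 * (CC * rbi * rbj * rbp ^ 2) * (Ai * Aj * Pj ^ 2) := by ring

/-! ### The top identity (the two outermost pairs, with the dangling window from below) -/

/-- `C(N,i)·i!·cWinK(i) = (−1)^{N−i} N!`. [folklore] -/
private theorem choose_cWinK {N i : ℕ} (hi : i ≤ N) : (N.choose i : ℚ) * (i ! : ℚ) * cWinK N i = (-1) ^ (N - i) * (N ! : ℚ) := by
  rw [cWinK_eq hi]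
  have h : ((N.choose i * i ! * (N - i)! : ℕ) : ℚ) = (N ! : ℚ) := by exact_mod_cast Nat.choose_mul_factorial_mul_factorial hi
  push_cast at h
  linear_combination (-1 : ℚ) ^ (N - i) * h

/-- The junction part: `(x')_j · xWinK(j) · n! · (1+ε+N)_k · (1−ε)_{k+j} (1+ε)_{N−j}
 = (−1)^j (1−ε)_n (1+ε)_n · C(n,k+j) · [R(0,k+j+1;−ε)(−ε)·(1−ε)_{k+j}] · [R(0,N−j+1;ε)ε·(1+ε)_{N−j}]`, i.e. with the
reciprocal bricks cleared. [cite: KrattenthalerRivoal2007, §13 (eq:briques) (the factor n!/((1−ε)_{k+i_B}(1+ε)_{n−k−i_B}))] -/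
private theorem junction_eq {k N j : ℕ} (hj : j ≤ N) {ε : ℚ} (h1 : ε < 1 / 2) (h2 : -(1 / 2) < ε) :
    xNumK N j ε * xWinK k N j ε * ((k + N)! : ℚ) * (∏ i' ∈ range k, (1 + ε + (N : ℚ) + i')) =
      (-1) ^ j * (∏ l ∈ range (k + N), (1 - ε + (l : ℚ))) * (∏ l ∈ range (k + N), (1 + ε + (l : ℚ))) *
        ((((k + N).choose (k + j) : ℕ) : ℚ) * rbMinus (k + j) ε * rbPlus (N - j) ε) := by
  obtain ⟨hAj, -, -⟩ := pw_shift_ne_zero h1 h2 (le_refl (1 : ℚ)) (k + j)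
  obtain ⟨-, hPj, -⟩ := pw_shift_ne_zero h1 h2 (le_refl (1 : ℚ)) (N - j)
  have c2 : xWinK k N j ε * pw (1 - ε) (k + j) = ∏ l ∈ range (k + N), (1 - ε + (l : ℚ)) := by rw [xWinK_mul hj, pw_def]
  have c6 : xNumK N j ε * pw (1 + ε) (N - j) = (-1) ^ j * pw (1 + ε) N := xNumK_mul hj ε
  have c7 : pw (1 + ε) N * (∏ i' ∈ range k, (1 + ε + (N : ℚ) + i')) = ∏ l ∈ range (k + N), (1 + ε + (l : ℚ)) := by
    rw [dplus_mul_P, pw_def]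
  have bj : rbMinus (k + j) ε * pw (1 - ε) (k + j) = ((k + j)! : ℚ) := by
    unfold rbMinus; rw [pw_def, div_mul_cancel₀ _ (by rwa [← pw_def])]
  have bp : rbPlus (N - j) ε * pw (1 + ε) (N - j) = ((N - j)! : ℚ) := by
    unfold rbPlus; rw [pw_def, div_mul_cancel₀ _ (by rwa [← pw_def])]
  have hint : ((((k + N).choose (k + j) : ℕ) : ℚ)) * ((k + j)! : ℚ) * ((N - j)! : ℚ) = ((k + N)! : ℚ) := by
    rw [show N - j = k + N - (k + j) by omega]
    exact_mod_cast Nat.choose_mul_factorial_mul_factorial (by omega : k + j ≤ k + N)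
  apply mul_right_cancel₀ (mul_ne_zero hAj hPj)
  rw [← c7]
  set Aj := pw (1 - ε) (k + j)
  set Pj := pw (1 + ε) (N - j)
  calc xNumK N j ε * xWinK k N j ε * ((k + N)! : ℚ) * (∏ i' ∈ range k, (1 + ε + (N : ℚ) + i')) * (Aj * Pj)
      = (xNumK N j ε * Pj) * (xWinK k N j ε * Aj) * ((k + N)! : ℚ) * (∏ i' ∈ range k, (1 + ε + (N : ℚ) + i')) := by ring
    _ = ((-1) ^ j * pw (1 + ε) N) * (∏ l ∈ range (k + N), (1 - ε + (l : ℚ))) *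
          (((((k + N).choose (k + j) : ℕ) : ℚ)) * (rbMinus (k + j) ε * Aj) * (rbPlus (N - j) ε * Pj)) *
          (∏ i' ∈ range k, (1 + ε + (N : ℚ) + i')) := by rw [c6, c2, bj, bp, hint]
    _ = _ := by ring

/-- **The top identity, case `i_m > i_{m−1}`** (`R₇ = ε·R₃`): for `1 ≤ k`, `j < i ≤ N`, `|ε| < 1/2`,
`[C(N,i) i! (k−ε)_{N−i} (x')_i]·[xWin(i) cWin(i) C(i,j) (ε)_{i−j} (x')_j (c₂)_j]·xWin(j) · n!² ((1+ε+N)_k)² k!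
 = (−1)^{N+j} N! (1−ε)_n³ (1+ε)_n² · C(i,j) C(n,k+j) · topBK(i,j) · R(0,k+j+1;−ε)(−ε) · R(0,N−j+1;ε)ε`.
[cite: KrattenthalerRivoal2007, §13 proof of Proposition 7 (R₇ = ε·R₃, Lemme 11)] -/
theorem topUnitK_eq_lt {k N i j : ℕ} (hk : 1 ≤ k) (hji : j < i) (hi : i ≤ N) {ε : ℚ} (h1 : ε < 1 / 2)
    (h2 : -(1 / 2) < ε) :
    ((N.choose i : ℚ) * (i ! : ℚ) * tGapK k N i ε * xNumK N i ε) *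
        (xWinK k N i ε * cWinK N i * (i.choose j : ℚ) * cGapK i j ε * xNumK N j ε * cNumK k j ε) *
        xWinK k N j ε * ((k + N)! : ℚ) ^ 2 * (∏ i' ∈ range k, (1 + ε + (N : ℚ) + i')) ^ 2 * (k ! : ℚ) =
      (-1) ^ (N + j) * (N ! : ℚ) * (∏ l ∈ range (k + N), (1 - ε + (l : ℚ))) ^ 3 *
        (∏ l ∈ range (k + N), (1 + ε + (l : ℚ))) ^ 2 *
        (((i.choose j * (k + N).choose (k + j) : ℕ) : ℚ) * topBK k N i j ε * rbMinus (k + j) ε * rbPlus (N - j) ε) := by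
  -- nonvanishing
  obtain ⟨hAi, -, -⟩ := pw_shift_ne_zero h1 h2 (le_refl (1 : ℚ)) (k + i)
  obtain ⟨-, hPi, -⟩ := pw_shift_ne_zero h1 h2 (le_refl (1 : ℚ)) (N - i)
  obtain ⟨hAkm, -, -⟩ := pw_shift_ne_zero h1 h2 (le_refl (1 : ℚ)) (k - 1)
  have hz : (1 : ℚ) ≤ ((k + N - i : ℕ) : ℚ) := by exact_mod_cast (show 1 ≤ k + N - i by omega)
  obtain ⟨hBi, -, -⟩ := pw_shift_ne_zero h1 h2 hz (i + 1)
  have hk2 : (k : ℚ) - 2 * ε ≠ 0 := by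
    have : (1 : ℚ) ≤ k := by exact_mod_cast hk
    intro h; linarith
  -- sub-identities stated before the abbreviations
  have t1 : (N.choose i : ℚ) * (i ! : ℚ) * cWinK N i = (-1) ^ (N - i) * (N ! : ℚ) := choose_cWinK hi
  have tj := junction_eq (k := k) (le_of_lt (lt_of_lt_of_le hji hi)) h1 h2
  -- atoms
  set Ai := pw (1 - ε) (k + i) with hAi'
  set Pi := pw (1 + ε) (N - i) with hPi'
  set Akm := pw (1 - ε) (k - 1) with hAkm'
  set Bi := pw (((k + N - i : ℕ) : ℚ) - ε) (i + 1) with hBi'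
  set G1 := pw (1 + ε) (i - j - 1) with hG1
  set Dm := ∏ l ∈ range (k + N), (1 - ε + (l : ℚ)) with hDm
  set Dp := ∏ l ∈ range (k + N), (1 + ε + (l : ℚ)) with hDp
  set Dplus := pw (1 + ε) N with hDplus
  set P := ∏ i' ∈ range k, (1 + ε + (N : ℚ) + i') with hP
  set nf := ((k + N)! : ℚ) with hnf
  have c2 : xWinK k N i ε * Ai = Dm := by rw [hAi', xWinK_mul hi, pw_def]
  have c6 : xNumK N i ε * Pi = (-1) ^ i * Dplus := xNumK_mul hi ε
  have c7 : Dplus * P = Dp := by rw [hDplus, hP, dplus_mul_P, pw_def]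
  have ct : Akm * tGapK k N i ε * Bi = Dm := by rw [hAkm', hBi', tGapK_mul hk hi, pw_def]
  have cg : cGapK i j ε = ε * G1 := by
    unfold cGapK
    rw [← pw_def, show i - j = (i - j - 1) + 1 by omega, pw_succ_left, hG1, pw_congr (show ε + 1 = 1 + ε by ring)]
  have bk : rbMinus (k - 1) ε * Akm = ((k - 1)! : ℚ) := by
    unfold rbMinus; rw [hAkm', pw_def, div_mul_cancel₀ _ (by rwa [← pw_def])]
  have hkf : (k ! : ℚ) = (k : ℚ) * ((k - 1)! : ℚ) := by
    exact_mod_cast (Nat.mul_factorial_pred (by omega : k ≠ 0)).symm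
  have hj2 : ((-1 : ℚ) ^ j) ^ 2 = 1 := by rw [← pow_mul]; exact Even.neg_one_pow ⟨j, by ring⟩
  have hK2 : (∏ t ∈ range (j + 1), ((k : ℚ) + t - 2 * ε)) = ((k : ℚ) - 2 * ε) * cNumK k j ε := by
    unfold cNumK
    rw [prod_congr rfl (fun (t : ℕ) _ => show (k : ℚ) + (t : ℚ) - 2 * ε = (k : ℚ) - 2 * ε + (t : ℚ) by ring),
      ← pw_def, ← pw_def,
      pw_succ_left, pw_congr (show (k : ℚ) - 2 * ε + 1 = 1 + (k : ℚ) - 2 * ε by ring)]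
  have hR3 : specialBrickR3 (k + N) k i j ε * (Bi * Ai * Pi) =
      nf * (((k : ℚ) - 2 * ε) * cNumK k j ε) * G1 := by
    unfold specialBrickR3
    have eB : (∏ t ∈ range (i + 1), (((k + N - i : ℕ) : ℚ) + t - ε)) = Bi := by
      rw [hBi', pw_def]; exact prod_congr rfl fun t _ => by ring
    have eP : (∏ t ∈ range (k + N - k - i), (1 + ε + (t : ℚ))) = Pi := by
      rw [hPi', pw_def, show k + N - k - i = N - i by omega]
    rw [eB, hK2, eP, ← pw_def, ← hG1, ← pw_def, ← hAi']
    rw [div_mul_cancel₀ _ (mul_ne_zero (mul_ne_zero hBi hAi) hPi)]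
  have hg2 : (k : ℚ) / ((k : ℚ) - 2 * ε) * ((k : ℚ) - 2 * ε) = k := div_mul_cancel₀ _ hk2
  have hs : (-1 : ℚ) ^ (N - i) * (-1) ^ i = (-1) ^ (N + j) * (-1) ^ j := by
    rw [← pow_add, ← pow_add, Nat.sub_add_cancel hi]
    rw [show N + j + j = N + 2 * j by ring, pow_add, pow_mul]
    norm_num
  -- assemble
  have hZ : Ai * Pi * Bi * Akm * ((k : ℚ) - 2 * ε) ≠ 0 := by
    apply_rules [mul_ne_zero]
  apply mul_right_cancel₀ hZ
  unfold topBK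
  rw [if_pos hji, cg, hkf]
  set Xwi := xWinK k N i ε
  set Xni := xNumK N i ε
  set Tg := tGapK k N i ε
  set Cn := cNumK k j ε
  set R3 := specialBrickR3 (k + N) k i j ε
  set g2 := (k : ℚ) / ((k : ℚ) - 2 * ε)
  set rbk := rbMinus (k - 1) ε
  set J := ((((k + N).choose (k + j) : ℕ) : ℚ) * rbMinus (k + j) ε * rbPlus (N - j) ε)
  calc (N.choose i : ℚ) * (i ! : ℚ) * Tg * Xni * (Xwi * cWinK N i * (i.choose j : ℚ) * (ε * G1) * xNumK N j ε * Cn) *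
        xWinK k N j ε * nf ^ 2 * P ^ 2 * ((k : ℚ) * ((k - 1)! : ℚ)) * (Ai * Pi * Bi * Akm * ((k : ℚ) - 2 * ε))
      = ((N.choose i : ℚ) * (i ! : ℚ) * cWinK N i) * (Akm * Tg * Bi) * (Xni * Pi) * (Xwi * Ai) *
          (xNumK N j ε * xWinK k N j ε * nf * P) *
          ((i.choose j : ℚ) * ε * G1 * Cn * nf * P * (k : ℚ) * ((k - 1)! : ℚ) * ((k : ℚ) - 2 * ε)) := by ring
    _ = ((-1) ^ (N - i) * (N ! : ℚ)) * Dm * ((-1) ^ i * Dplus) * Dm * ((-1) ^ j * Dm * Dp * J) *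
          ((i.choose j : ℚ) * ε * G1 * Cn * nf * P * (k : ℚ) * ((k - 1)! : ℚ) * ((k : ℚ) - 2 * ε)) := by
        rw [t1, ct, c6, c2, tj]
    _ = ((-1) ^ (N - i) * (-1) ^ i) * (N ! : ℚ) * Dm ^ 3 * (Dplus * P) * Dp * (-1) ^ j * J *
          ((i.choose j : ℚ) * ε * (nf * (((k : ℚ) - 2 * ε) * Cn) * G1) * (k : ℚ) * ((k - 1)! : ℚ)) := by ring
    _ = ((-1) ^ (N + j) * (-1) ^ j) * (N ! : ℚ) * Dm ^ 3 * Dp * Dp * (-1) ^ j * J *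
          ((i.choose j : ℚ) * ε * (R3 * (Bi * Ai * Pi)) * (g2 * ((k : ℚ) - 2 * ε)) * (rbk * Akm)) := by
        rw [hs, c7, hR3, hg2, bk]
    _ = (-1) ^ (N + j) * (N ! : ℚ) * Dm ^ 3 * Dp ^ 2 *
          ((((i.choose j : ℚ) * (((k + N).choose (k + j) : ℕ) : ℚ)) * (ε * R3 * g2 * rbk) * rbMinus (k + j) ε *
            rbPlus (N - j) ε)) * (Ai * Pi * Bi * Akm * ((k : ℚ) - 2 * ε)) * ((-1) ^ j) ^ 2 := by
        simp only [J]; ring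
    _ = _ := by rw [hj2, mul_one]; push_cast; ring

/-- **The top identity, case `i_m = i_{m−1}`** (elementary bricks): for `1 ≤ k`, `i ≤ N`, `|ε| < 1/2`, the same
left-hand side at `j = i` equals `(−1)^{N+i} N! (1−ε)_n³ (1+ε)_n² · C(n,k+i) · topBK(i,i) · R(0,k+i+1;−ε)(−ε) R(0,N−i+1;ε)ε`.
[cite: KrattenthalerRivoal2007, §13 proof of Proposition 7 (the case i_{A/2+B} = i_{A/2+B−1}: seven elementary bricks)] -/
theorem topUnitK_eq_eq {k N i : ℕ} (hk : 1 ≤ k) (hi : i ≤ N) {ε : ℚ} (h1 : ε < 1 / 2) (h2 : -(1 / 2) < ε) :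
    ((N.choose i : ℚ) * (i ! : ℚ) * tGapK k N i ε * xNumK N i ε) *
        (xWinK k N i ε * cWinK N i * (i.choose i : ℚ) * cGapK i i ε * xNumK N i ε * cNumK k i ε) *
        xWinK k N i ε * ((k + N)! : ℚ) ^ 2 * (∏ i' ∈ range k, (1 + ε + (N : ℚ) + i')) ^ 2 * (k ! : ℚ) =
      (-1) ^ (N + i) * (N ! : ℚ) * (∏ l ∈ range (k + N), (1 - ε + (l : ℚ))) ^ 3 *
        (∏ l ∈ range (k + N), (1 + ε + (l : ℚ))) ^ 2 *
        (((i.choose i * (k + N).choose (k + i) : ℕ) : ℚ) * topBK k N i i ε * rbMinus (k + i) ε * rbPlus (N - i) ε) := by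
  -- nonvanishing
  obtain ⟨hAi, -, -⟩ := pw_shift_ne_zero h1 h2 (le_refl (1 : ℚ)) (k + i)
  obtain ⟨-, hPi, -⟩ := pw_shift_ne_zero h1 h2 (le_refl (1 : ℚ)) (N - i)
  obtain ⟨hAkm, -, -⟩ := pw_shift_ne_zero h1 h2 (le_refl (1 : ℚ)) (k - 1)
  obtain ⟨hDm0, -, hT2⟩ := pw_shift_ne_zero h1 h2 (le_refl (1 : ℚ)) (k + N)
  obtain ⟨-, -, hT2k⟩ := pw_shift_ne_zero h1 h2 (le_refl (1 : ℚ)) k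
  have hz : (1 : ℚ) ≤ ((k + N - i : ℕ) : ℚ) := by exact_mod_cast (show 1 ≤ k + N - i by omega)
  obtain ⟨hBi, -, -⟩ := pw_shift_ne_zero h1 h2 hz (i + 1)
  have hF1 : ((k + i)! : ℚ) ≠ 0 := by positivity
  have hF2 : ((k + N - i - 1)! : ℚ) ≠ 0 := by positivity
  -- sub-identities stated before the abbreviations
  have t1 : (N.choose i : ℚ) * (i ! : ℚ) * cWinK N i = (-1) ^ (N - i) * (N ! : ℚ) := choose_cWinK hi
  have tj := junction_eq (k := k) hi h1 h2
  have b3 : rbMinus (k + N) ε * (∏ l ∈ range (k + N), (1 - ε + (l : ℚ))) = ((k + N)! : ℚ) := by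
    unfold rbMinus; rw [div_mul_cancel₀ _ (by rwa [← pw_def])]
  -- atoms
  set Ai := pw (1 - ε) (k + i) with hAi'
  set Pi := pw (1 + ε) (N - i) with hPi'
  set Akm := pw (1 - ε) (k - 1) with hAkm'
  set Bi := pw (((k + N - i : ℕ) : ℚ) - ε) (i + 1) with hBi'
  set T2 := ∏ l ∈ range k, (1 - 2 * ε + (l : ℚ)) with hT2'
  set Lm := pw (1 - ε) (k + N - i - 1) with hLm
  set Dm := ∏ l ∈ range (k + N), (1 - ε + (l : ℚ)) with hDm
  set Dp := ∏ l ∈ range (k + N), (1 + ε + (l : ℚ)) with hDp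
  set Dplus := pw (1 + ε) N with hDplus
  set P := ∏ i' ∈ range k, (1 + ε + (N : ℚ) + i') with hP
  set nf := ((k + N)! : ℚ) with hnf
  set F1 := ((k + i)! : ℚ) with hF1'
  set F2 := ((k + N - i - 1)! : ℚ) with hF2'
  have hT20 : T2 ≠ 0 := by rw [hT2', ← pw_def]; exact hT2k
  -- sub-identities
  have c2 : xWinK k N i ε * Ai = Dm := by rw [hAi', xWinK_mul hi, pw_def]
  have c6 : xNumK N i ε * Pi = (-1) ^ i * Dplus := xNumK_mul hi ε
  have c7 : Dplus * P = Dp := by rw [hDplus, hP, dplus_mul_P, pw_def]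
  have ct : Akm * tGapK k N i ε * Bi = Dm := by rw [hAkm', hBi', tGapK_mul hk hi, pw_def]
  have cg : cGapK i i ε = 1 := by unfold cGapK; simp
  have hLB : Lm * Bi = Dm := by
    have e2 : ((k + N - i - 1 : ℕ) : ℚ) + 1 = ((k + N - i : ℕ) : ℚ) := by norm_cast; omega
    rw [hLm, hBi', hDm, ← pw_def, ← pw_congr (show 1 - ε + ((k + N - i - 1 : ℕ) : ℚ) = ((k + N - i : ℕ) : ℚ) - ε by
      linear_combination e2) (i + 1), ← pw_add]
    congr 1
    omega
  have hP2 : pw (1 - 2 * ε) (k + i) = T2 * cNumK k i ε := by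
    rw [pw_add, hT2', pw_def]
    unfold cNumK
    rw [← pw_def ((1 : ℚ) + k - 2 * ε), pw_congr (show (1 : ℚ) - 2 * ε + (k : ℚ) = 1 + (k : ℚ) - 2 * ε by ring) i]
  have hC : ((((k + N - i - 1).choose (k - 1) : ℕ) : ℚ)) * ((k - 1)! : ℚ) * ((N - i)! : ℚ) = F2 := by
    rw [hF2', show N - i = (k + N - i - 1) - (k - 1) by omega]
    exact_mod_cast Nat.choose_mul_factorial_mul_factorial (by omega : k - 1 ≤ k + N - i - 1)
  have b1 : polyBrick 1 (k + i) (-(2 * ε)) * F1 = pw (1 - 2 * ε) (k + i) := by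
    unfold polyBrick
    rw [hF1', div_mul_cancel₀ _ hF1, ← pw_def]
    exact pw_congr (by push_cast; ring) _
  have b2 : (k ! : ℚ) / T2 * T2 = (k ! : ℚ) := div_mul_cancel₀ _ hT20
  have b4 : polyBrick 1 (k + N - i - 1) (-ε) * F2 = Lm := by
    unfold polyBrick
    rw [hF2', div_mul_cancel₀ _ hF2, hLm, ← pw_def]
    exact pw_congr (by push_cast; ring) _
  have b5 : rbMinus (k - 1) ε * Akm = ((k - 1)! : ℚ) := by
    unfold rbMinus; rw [hAkm', pw_def, div_mul_cancel₀ _ (by rwa [← pw_def])]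
  have b6 : rbPlus (N - i) ε * Pi = ((N - i)! : ℚ) := by
    unfold rbPlus; rw [hPi', pw_def, div_mul_cancel₀ _ (by rwa [← pw_def])]
  have b7 : rbMinus (k + i) ε * Ai = F1 := by
    unfold rbMinus; rw [hAi', hF1', pw_def, div_mul_cancel₀ _ (by rwa [← pw_def])]
  have hX : topBK k N i i ε * (T2 * Akm * Bi * Dm * Ai * Pi * F1 * F2) = T2 * cNumK k i ε * (k ! : ℚ) * nf * Dm * F1 * F2 := by
    unfold topBK
    rw [if_neg (lt_irrefl i)]
    set pB2 := polyBrick 1 (k + i) (-(2 * ε))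
    set pBm := polyBrick 1 (k + N - i - 1) (-ε)
    set CC := ((((k + N - i - 1).choose (k - 1) : ℕ) : ℚ))
    calc pB2 * ((k ! : ℚ) / T2) * rbMinus (k + N) ε * pBm * CC * rbMinus (k - 1) ε * rbPlus (N - i) ε * rbMinus (k + i) ε *
          (T2 * Akm * Bi * Dm * Ai * Pi * F1 * F2)
        = (pB2 * F1) * ((k ! : ℚ) / T2 * T2) * (rbMinus (k + N) ε * Dm) * (pBm * F2) * Bi *
            (CC * (rbMinus (k - 1) ε * Akm) * (rbPlus (N - i) ε * Pi)) * (rbMinus (k + i) ε * Ai) := by ring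
      _ = pw (1 - 2 * ε) (k + i) * (k ! : ℚ) * nf * Lm * Bi * (CC * ((k - 1)! : ℚ) * ((N - i)! : ℚ)) * F1 := by
          rw [b1, b2, b3, b4, b5, b6, b7]
      _ = (T2 * cNumK k i ε) * (k ! : ℚ) * nf * (Lm * Bi) * F2 * F1 := by rw [hP2, hC]; ring
      _ = _ := by rw [hLB]; ring
  have hs : (-1 : ℚ) ^ (N - i) * (-1) ^ i * (-1) ^ i = (-1) ^ (N + i) := by
    rw [← pow_add, ← pow_add]
    congr 1
    omega
  -- assemble
  have hZ : Ai * Pi * (T2 * Akm * Bi * Dm * Ai * Pi * F1 * F2) ≠ 0 := by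
    apply_rules [mul_ne_zero]
  apply mul_right_cancel₀ hZ
  rw [cg, Nat.choose_self]
  set Xwi := xWinK k N i ε
  set Xni := xNumK N i ε
  set Tg := tGapK k N i ε
  set Cn := cNumK k i ε
  set TB := topBK k N i i ε
  set J := ((((k + N).choose (k + i) : ℕ) : ℚ) * rbMinus (k + i) ε * rbPlus (N - i) ε)
  set ZZ := T2 * Akm * Bi * Dm * Ai * Pi * F1 * F2
  calc (N.choose i : ℚ) * (i ! : ℚ) * Tg * Xni * (Xwi * cWinK N i * ((1 : ℕ) : ℚ) * 1 * Xni * Cn) * Xwi * nf ^ 2 * P ^ 2 *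
        (k ! : ℚ) * (Ai * Pi * ZZ)
      = ((N.choose i : ℚ) * (i ! : ℚ) * cWinK N i) * (Akm * Tg * Bi) * (Xni * Pi) * (Xwi * Ai) * (Xni * Xwi * nf * P) *
          (Cn * nf * P * (k ! : ℚ) * T2 * Dm * Ai * Pi * F1 * F2) := by simp only [ZZ, Nat.cast_one]; ring
    _ = ((-1) ^ (N - i) * (N ! : ℚ)) * Dm * ((-1) ^ i * Dplus) * Dm * ((-1) ^ i * Dm * Dp * J) *
          (Cn * nf * P * (k ! : ℚ) * T2 * Dm * Ai * Pi * F1 * F2) := by rw [t1, ct, c6, c2, tj]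
    _ = ((-1) ^ (N - i) * (-1) ^ i * (-1) ^ i) * (N ! : ℚ) * Dm ^ 3 * (Dplus * P) * Dp * J *
          (T2 * Cn * (k ! : ℚ) * nf * Dm * F1 * F2) * Ai * Pi := by ring
    _ = (-1) ^ (N + i) * (N ! : ℚ) * Dm ^ 3 * Dp * Dp * J * (TB * ZZ) * Ai * Pi := by rw [hs, c7, hX]
    _ = _ := by simp only [J]; push_cast; ring

/-! ### The dictionaries: raw sub-chains × normalisers = windows × normalised inner sums -/

/-- Unfolding `innerK` at a `(x',y')`-level. [cite: KrattenthalerRivoal2007, §13 (eq:briques)] -/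
theorem innerK_y_succ (k N r : ℕ) (odd : Bool) (b i : ℕ) (ε : ℚ) :
    innerK k N r odd 0 (b + 1) i ε = ∑ j ∈ range (i + 1), (i.choose j : ℚ) * lvYK k N r i j ε * innerK k N r odd 0 b j ε := by
  rw [innerK]

/-- Unfolding `innerK` at a `(x',x')`-level. [cite: KrattenthalerRivoal2007, §13 (eq:briques)] -/
theorem innerK_x_succ (k N r : ℕ) (odd : Bool) (m b i : ℕ) (ε : ℚ) :
    innerK k N r odd (m + 1) b i ε = ∑ j ∈ range (i + 1), lvXK k N i j ε * innerK k N r odd m b j ε := by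
  rw [innerK]

/-- Unfolding `innerK` at the base. [cite: KrattenthalerRivoal2007, §13 (eq:briques)] -/
theorem innerK_base (k N r : ℕ) (odd : Bool) (i : ℕ) (ε : ℚ) :
    innerK k N r odd 0 0 i ε = if odd then 1 else if i = 0 then 1 else 0 := by
  rw [innerK]

/-- **Dictionary, odd `(x',y')`-chain**: for `|ε| < 1/2`, `r ≥ 1`, `i ≤ N`,
`((1−ε)_{rn}(rn+1−ε)_k (1+ε)_{rn}(1+ε+N)_k)^b · rawK(true,0,b,i) = ((−1)^N (1+ε)_n (1−ε)_n n!^{2r})^b · xWin(i) · innerK(true,0,b,i)`.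
[cite: KrattenthalerRivoal2007, §13 proof of Proposition 7 (odd A, Corollaire 2)] -/
theorem rawK_dict_odd_y (k N r : ℕ) (hr : 1 ≤ r) (ε : ℚ) : ∀ b i : ℕ, i ≤ N →
    (((∏ l ∈ range (r * (k + N)), (1 - ε + (l : ℚ))) * ∏ i' ∈ range k, (((r * (k + N) : ℕ) : ℚ) + 1 - ε + i')) *
        ((∏ l ∈ range (r * (k + N)), (1 + ε + (l : ℚ))) * ∏ i' ∈ range k, (1 + ε + (N : ℚ) + i'))) ^ b *
      rawK k N r true 0 b i ε =
    ((-1) ^ N * (∏ l ∈ range (k + N), (1 + ε + (l : ℚ))) * (∏ l ∈ range (k + N), (1 - ε + (l : ℚ))) *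
        ((k + N)! : ℚ) ^ (2 * r)) ^ b * xWinK k N i ε * innerK k N r true 0 b i ε := by
  intro b
  induction b with
  | zero => intro i _; rw [rawK_base_odd, innerK_base]; simp
  | succ b ih =>
    intro i hi
    rw [rawK_y_succ k N r true b hi, innerK_y_succ]
    simp only [mul_sum]
    refine sum_congr rfl fun j hj => ?_
    have hji : j ≤ i := Nat.lt_succ_iff.mp (mem_range.mp hj)
    have hih := ih j (hji.trans hi)
    have hu := yUnitK_eq (k := k) hr hji hi ε
    set E := ((∏ l ∈ range (r * (k + N)), (1 - ε + (l : ℚ))) * ∏ i' ∈ range k, (((r * (k + N) : ℕ) : ℚ) + 1 - ε + i')) *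
        ((∏ l ∈ range (r * (k + N)), (1 + ε + (l : ℚ))) * ∏ i' ∈ range k, (1 + ε + (N : ℚ) + i'))
    set D := (-1) ^ N * (∏ l ∈ range (k + N), (1 + ε + (l : ℚ))) * (∏ l ∈ range (k + N), (1 - ε + (l : ℚ))) *
        ((k + N)! : ℚ) ^ (2 * r)
    linear_combination (E * xWinK k N i ε * yWinK k N r i ε * (i.choose j : ℚ) * yGapK k N r i j * xNumK N j ε *
      yNumK k N r j ε) * hih + (xWinK k N i ε * (i.choose j : ℚ) * D ^ b * innerK k N r true 0 b j ε) * hu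

/-- **Dictionary, even `(x',y')`-chain** (`b+1 ≥ 1` levels, the innermost on the base `[j=0]`): for `r ≥ 1`, `i ≤ N`,
`E^{b+1} · rawK(false,0,b+1,i) = (−1)^{N(b+1)} (k!·R(k,0;1−ε)) n!^{2r(b+1)} (1+ε)_n^{b+1} (1−ε)_n^{b} · xWin(i) · innerK(false,0,b+1,i)`.
[cite: KrattenthalerRivoal2007, §13 proof of Proposition 7 (even A, Corollaire 1)] -/
theorem rawK_dict_even_y (k N r : ℕ) (hr : 1 ≤ r) (ε : ℚ) : ∀ b i : ℕ, i ≤ N →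
    (((∏ l ∈ range (r * (k + N)), (1 - ε + (l : ℚ))) * ∏ i' ∈ range k, (((r * (k + N) : ℕ) : ℚ) + 1 - ε + i')) *
        ((∏ l ∈ range (r * (k + N)), (1 + ε + (l : ℚ))) * ∏ i' ∈ range k, (1 + ε + (N : ℚ) + i'))) ^ (b + 1) *
      rawK k N r false 0 (b + 1) i ε =
    (-1) ^ (N * (b + 1)) * ((k ! : ℚ) * polyBrick 1 k (-ε)) * ((k + N)! : ℚ) ^ (2 * r * (b + 1)) *
      (∏ l ∈ range (k + N), (1 + ε + (l : ℚ))) ^ (b + 1) * (∏ l ∈ range (k + N), (1 - ε + (l : ℚ))) ^ b *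
      xWinK k N i ε * innerK k N r false 0 (b + 1) i ε := by
  intro b
  induction b with
  | zero =>
    intro i hi
    rw [rawK_y_succ k N r false 0 hi, innerK_y_succ]
    have hraw : ∑ j ∈ range (i + 1), (i.choose j : ℚ) * yGapK k N r i j * xNumK N j ε * yNumK k N r j ε *
        rawK k N r false 0 0 j ε = yGapK k N r i 0 := by
      rw [sum_eq_single 0 (fun j _ hj => by rw [rawK_base_even, if_neg hj]; ring)
        (fun h => absurd (mem_range.2 (Nat.succ_pos i)) h), rawK_base_even]
      simp [xNumK, yNumK]
    have hinn : ∑ j ∈ range (i + 1), (i.choose j : ℚ) * lvYK k N r i j ε * innerK k N r false 0 0 j ε = lvYK k N r i 0 ε := by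
      rw [sum_eq_single 0 (fun j _ hj => by rw [innerK_base]; simp [hj])
        (fun h => absurd (mem_range.2 (Nat.succ_pos i)) h), innerK_base]
      simp
    rw [hraw, hinn]
    have hu := yUnitK0_eq (k := k) hr hi ε
    linear_combination xWinK k N i ε * hu
  | succ b ih =>
    intro i hi
    rw [rawK_y_succ k N r false (b + 1) hi, innerK_y_succ k N r false (b + 1)]
    simp only [mul_sum]
    refine sum_congr rfl fun j hj => ?_
    have hji : j ≤ i := Nat.lt_succ_iff.mp (mem_range.mp hj)
    have hih := ih j (hji.trans hi)
    have hu := yUnitK_eq (k := k) hr hji hi ε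
    set E := ((∏ l ∈ range (r * (k + N)), (1 - ε + (l : ℚ))) * ∏ i' ∈ range k, (((r * (k + N) : ℕ) : ℚ) + 1 - ε + i')) *
        ((∏ l ∈ range (r * (k + N)), (1 + ε + (l : ℚ))) * ∏ i' ∈ range k, (1 + ε + (N : ℚ) + i'))
    set Db := (-1) ^ (N * (b + 1)) * ((k ! : ℚ) * polyBrick 1 k (-ε)) * ((k + N)! : ℚ) ^ (2 * r * (b + 1)) *
      (∏ l ∈ range (k + N), (1 + ε + (l : ℚ))) ^ (b + 1) * (∏ l ∈ range (k + N), (1 - ε + (l : ℚ))) ^ b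
    have hpow : (-1 : ℚ) ^ (N * (b + 1 + 1)) = (-1) ^ (N * (b + 1)) * (-1) ^ N := by rw [← pow_add]; congr 1
    have hpow2 : ((k + N)! : ℚ) ^ (2 * r * (b + 1 + 1)) = ((k + N)! : ℚ) ^ (2 * r * (b + 1)) * ((k + N)! : ℚ) ^ (2 * r) := by
      rw [← pow_add, show 2 * r * (b + 1 + 1) = 2 * r * (b + 1) + 2 * r by ring]
    rw [hpow, hpow2]
    linear_combination (E * xWinK k N i ε * yWinK k N r i ε * (i.choose j : ℚ) * yGapK k N r i j * xNumK N j ε *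
      yNumK k N r j ε) * hih + (xWinK k N i ε * (i.choose j : ℚ) * Db * innerK k N r false 0 (b + 1) j ε) * hu

/-- **Dictionary, `(x',x')`-chain** on top of any normalised base: if `E·rawK(0,b,i) = D·xWin(i)·innerK(0,b,i)` for all
`i ≤ N`, then `(n!²((1+ε+N)_k)²)^m E · rawK(m,b,i) = ((1−ε)_n²(1+ε)_n²)^m D · xWin(i) · innerK(m,b,i)` (`|ε| < 1/2`).
[cite: KrattenthalerRivoal2007, §13 (eq:briques), the (x',x') levels] -/
theorem rawK_dict_x (k N r : ℕ) (odd : Bool) (b : ℕ) {ε : ℚ} (h1 : ε < 1 / 2) (h2 : -(1 / 2) < ε) {E D : ℚ}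
    (hbase : ∀ i, i ≤ N → E * rawK k N r odd 0 b i ε = D * xWinK k N i ε * innerK k N r odd 0 b i ε) :
    ∀ m i : ℕ, i ≤ N →
      (((k + N)! : ℚ) ^ 2 * (∏ i' ∈ range k, (1 + ε + (N : ℚ) + i')) ^ 2) ^ m * E * rawK k N r odd m b i ε =
        ((∏ l ∈ range (k + N), (1 - ε + (l : ℚ))) ^ 2 * (∏ l ∈ range (k + N), (1 + ε + (l : ℚ))) ^ 2) ^ m * D *
          xWinK k N i ε * innerK k N r odd m b i ε := by
  intro m
  induction m with
  | zero => intro i hi; simpa using hbase i hi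
  | succ m ih =>
    intro i hi
    rw [rawK_x_succ k N r odd m b hi, innerK_x_succ]
    simp only [mul_sum]
    refine sum_congr rfl fun j hj => ?_
    have hji : j ≤ i := Nat.lt_succ_iff.mp (mem_range.mp hj)
    have hih := ih j (hji.trans hi)
    have hu := xUnitK_eq (k := k) hji hi h1 h2
    set EX := ((k + N)! : ℚ) ^ 2 * (∏ i' ∈ range k, (1 + ε + (N : ℚ) + i')) ^ 2
    set DX := (∏ l ∈ range (k + N), (1 - ε + (l : ℚ))) ^ 2 * (∏ l ∈ range (k + N), (1 + ε + (l : ℚ))) ^ 2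
    linear_combination (EX * xWinK k N i ε * xWinK k N i ε * (i.choose j : ℚ) * xGapK k N i j * xNumK N j ε *
      xNumK N j ε) * hih + (xWinK k N i ε * DX ^ m * D * innerK k N r odd m b j ε) * hu

/-! ### Assembly -/

/-- **The core identity**: the reduced multiple sum of the full chain, times the top normalisers and the normalisers
of the sub-chain, is `(−1)^N N! (1−ε)_n³ (1+ε)_n² · D · gSumK`. [cite: KrattenthalerRivoal2007, §13 (eq:briques)] -/
theorem core_eq_gSumK (k N r M B : ℕ) (odd : Bool) (hk : 1 ≤ k) {ε : ℚ} (h1 : ε < 1 / 2) (h2 : -(1 / 2) < ε)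
    {E D : ℚ} (hdict : ∀ j, j ≤ N →
      (((k + N)! : ℚ) ^ 2 * (∏ i' ∈ range k, (1 + ε + (N : ℚ) + i')) ^ 2) ^ M * E * rawK k N r odd M B j ε =
        ((∏ l ∈ range (k + N), (1 - ε + (l : ℚ))) ^ 2 * (∏ l ∈ range (k + N), (1 + ε + (l : ℚ))) ^ 2) ^ M * D *
          xWinK k N j ε * innerK k N r odd M B j ε) :
    linkReducedMultiSum (-(N : ℚ) + k - 2 * ε)
        ((-(N : ℚ) - ε, some 1) :: (-(N : ℚ) - ε, some (1 + (k : ℚ) - 2 * ε)) :: chainK k N r odd M B ε) N *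
      (((k + N)! : ℚ) ^ 2 * (∏ i' ∈ range k, (1 + ε + (N : ℚ) + i')) ^ 2 * (k ! : ℚ)) *
      ((((k + N)! : ℚ) ^ 2 * (∏ i' ∈ range k, (1 + ε + (N : ℚ) + i')) ^ 2) ^ M * E) =
    (-1) ^ N * (N ! : ℚ) * (∏ l ∈ range (k + N), (1 - ε + (l : ℚ))) ^ 3 * (∏ l ∈ range (k + N), (1 + ε + (l : ℚ))) ^ 2 *
      (((∏ l ∈ range (k + N), (1 - ε + (l : ℚ))) ^ 2 * (∏ l ∈ range (k + N), (1 + ε + (l : ℚ))) ^ 2) ^ M * D) *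
      gSumK k N r M B odd ε := by
  rw [top_expand]
  unfold gSumK
  simp only [sum_mul, mul_sum]
  refine sum_congr rfl fun i hi => sum_congr rfl fun j hj => ?_
  have hiN : i ≤ N := Nat.lt_succ_iff.mp (mem_range.mp hi)
  have hji : j ≤ i := Nat.lt_succ_iff.mp (mem_range.mp hj)
  have hd := hdict j (hji.trans hiN)
  set DX := ((∏ l ∈ range (k + N), (1 - ε + (l : ℚ))) ^ 2 * (∏ l ∈ range (k + N), (1 + ε + (l : ℚ))) ^ 2) ^ M
  rcases Nat.lt_or_ge j i with hlt | hge
  · have ht := topUnitK_eq_lt (k := k) hk hlt hiN h1 h2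
    linear_combination ((N.choose i : ℚ) * tGapK k N i ε * xNumK N i ε * (i ! : ℚ) *
      (xWinK k N i ε * cWinK N i * ((i.choose j : ℚ) * cGapK i j ε * xNumK N j ε * cNumK k j ε)) *
      (((k + N)! : ℚ) ^ 2 * (∏ i' ∈ range k, (1 + ε + (N : ℚ) + i')) ^ 2 * (k ! : ℚ))) * hd +
      (DX * D * innerK k N r odd M B j ε) * ht
  · have hij : j = i := le_antisymm hji hge
    subst hij
    have ht := topUnitK_eq_eq (k := k) hk hiN h1 h2
    linear_combination ((N.choose j : ℚ) * tGapK k N j ε * xNumK N j ε * (j ! : ℚ) *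
      (xWinK k N j ε * cWinK N j * ((j.choose j : ℚ) * cGapK j j ε * xNumK N j ε * cNumK k j ε)) *
      (((k + N)! : ℚ) ^ 2 * (∏ i' ∈ range k, (1 + ε + (N : ℚ) + i')) ^ 2 * (k ! : ℚ))) * hd +
      (DX * D * innerK k N r odd M B j ε) * ht

/-- `corTwoParamsK` is the two top pairs on `chainK … true`. [cite: KrattenthalerRivoal2007, §9 proof of Corollaire 2] -/
theorem corTwoParamsK_eq_chainK (ε : ℚ) (N k M B r : ℕ) :
    corTwoParamsK ε N k M B r =
      (-(N : ℚ) - ε, some 1) :: (-(N : ℚ) - ε, some (1 + (k : ℚ) - 2 * ε)) :: chainK k N r true M B ε := by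
  simp [corTwoParamsK, chainK, List.append_assoc]

/-- `corOneParamsK`, as a link list, is the two top pairs on `chainK … false`. [cite: KrattenthalerRivoal2007, §9 proof of Corollaire 1] -/
theorem corOneParamsK_map_eq_chainK (ε : ℚ) (N k M B r : ℕ) :
    (corOneParamsK ε N k M B r).map (fun bc => (bc.1, some bc.2)) =
      (-(N : ℚ) - ε, some 1) :: (-(N : ℚ) - ε, some (1 + (k : ℚ) - 2 * ε)) :: chainK k N r false M B ε := by
  simp [corOneParamsK, chainK]

/-- Nonvanishing of the normalisers for `|ε| < 1/2`. [folklore] -/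
private theorem norms_ne_zero {ε : ℚ} (h1 : ε < 1 / 2) (h2 : -(1 / 2) < ε) (m : ℕ) :
    (∏ l ∈ range m, (1 - ε + (l : ℚ))) ≠ 0 ∧ (∏ l ∈ range m, (1 + ε + (l : ℚ))) ≠ 0 := by
  obtain ⟨a, b, -⟩ := pw_shift_ne_zero h1 h2 (le_refl (1 : ℚ)) m
  exact ⟨by rwa [← pw_def], by rwa [← pw_def]⟩

/-- **`gTailOdd` in brick form** (`k ≥ 1`, `r ≥ 1`, `|ε| < 1/2`):
`gTailOdd = −((−1)^{rn})^B · C(n,k) · R(0,N+1;ε)ε · gSumK(odd)`.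
[cite: KrattenthalerRivoal2007, §13 proof of Proposition 7 («le cas que A est impair … Corollaire 2»)] -/
theorem gTailOdd_eq_bricks (k N M B r : ℕ) (hk : 1 ≤ k) (hr : 1 ≤ r) {ε : ℚ} (h1 : ε < 1 / 2) (h2 : -(1 / 2) < ε) :
    gTailOdd k N M B r ε = -((-1 : ℚ) ^ (r * (k + N))) ^ B * ((((k + N).choose k : ℕ) : ℚ) * rbPlus N ε) *
      gSumK k N r M B true ε := by
  obtain ⟨hDm, hDp⟩ := norms_ne_zero h1 h2 (k + N)
  obtain ⟨-, hDplus⟩ := norms_ne_zero h1 h2 N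
  have hnf : ((k + N)! : ℚ) ≠ 0 := by positivity
  have hNf : (N ! : ℚ) ≠ 0 := by positivity
  have hkf : (k ! : ℚ) ≠ 0 := by positivity
  -- the dictionaries
  have hy := rawK_dict_odd_y k N r hr ε B
  have hx := rawK_dict_x k N r true B h1 h2 (fun i hi => hy i hi)
  have hcore := core_eq_gSumK k N r M B true hk h1 h2 (fun j hj => hx M j hj)
  -- the junction with the prefactor
  have c7 : (∏ l ∈ range N, (1 + ε + (l : ℚ))) * (∏ i' ∈ range k, (1 + ε + (N : ℚ) + i')) =
      ∏ l ∈ range (k + N), (1 + ε + (l : ℚ)) := by rw [← pw_def, dplus_mul_P, pw_def]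
  have bp : rbPlus N ε * (∏ l ∈ range N, (1 + ε + (l : ℚ))) = (N ! : ℚ) := by
    unfold rbPlus; rw [div_mul_cancel₀ _ hDplus]
  have hch : ((((k + N).choose k : ℕ) : ℚ)) * (k ! : ℚ) * (N ! : ℚ) = ((k + N)! : ℚ) := by
    have h := Nat.choose_mul_factorial_mul_factorial (show k ≤ k + N by omega)
    rw [show k + N - k = N by omega] at h
    exact_mod_cast h
  have hsgn : (-1 : ℚ) ^ (N * (B + 1) + 1) * ((-1) ^ N * ((-1) ^ N) ^ B) = -1 := by
    rw [← pow_mul, ← pow_add, ← pow_add, show N * (B + 1) + 1 + (N + N * B) = 2 * (N * (B + 1)) + 1 by ring,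
      pow_add, pow_mul, neg_one_sq, one_pow, one_mul, pow_one]
  unfold gTailOdd
  rw [corTwoParamsK_eq_chainK]
  set red := linkReducedMultiSum (-(N : ℚ) + k - 2 * ε)
    ((-(N : ℚ) - ε, some 1) :: (-(N : ℚ) - ε, some (1 + (k : ℚ) - 2 * ε)) :: chainK k N r true M B ε) N
  set Dm := ∏ l ∈ range (k + N), (1 - ε + (l : ℚ))
  set Dp := ∏ l ∈ range (k + N), (1 + ε + (l : ℚ))
  set Dplus := ∏ l ∈ range N, (1 + ε + (l : ℚ))
  set Rm := ∏ l ∈ range (r * (k + N)), (1 - ε + (l : ℚ))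
  set Rp := ∏ l ∈ range (r * (k + N)), (1 + ε + (l : ℚ))
  set P := ∏ i' ∈ range k, (1 + ε + (N : ℚ) + i')
  set Q := ∏ i' ∈ range k, (((r * (k + N) : ℕ) : ℚ) + 1 - ε + i')
  set nf := ((k + N)! : ℚ)
  set G := gSumK k N r M B true ε
  have hK : (Dm * Dp) ^ (2 * M + 3 + B) * nf ^ (2 * B * r) * (N ! : ℚ) * ((k ! : ℚ) * Dplus) ≠ 0 := by
    apply_rules [mul_ne_zero, pow_ne_zero]
  apply mul_right_cancel₀ hK
  have eg : ((-1 : ℚ) ^ (r * (k + N))) ^ B * (-1) ^ (N * (B + 1) + 1) *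
      (nf ^ (2 * M + 3) * (Rm * Rp) ^ B * P ^ (2 * M + 3 + B) * Q ^ B / ((Dm * Dp) ^ (2 * M + 3 + B) * nf ^ (2 * B * r) * (N ! : ℚ))) *
      red * ((Dm * Dp) ^ (2 * M + 3 + B) * nf ^ (2 * B * r) * (N ! : ℚ) * ((k ! : ℚ) * Dplus)) =
      ((-1 : ℚ) ^ (r * (k + N))) ^ B * (-1) ^ (N * (B + 1) + 1) * nf * P * Dplus *
        (red * (nf ^ 2 * P ^ 2 * (k ! : ℚ)) * ((nf ^ 2 * P ^ 2) ^ M * ((Rm * Q) * (Rp * P)) ^ B)) := by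
    field_simp
    ring
  rw [eg, hcore]
  set S := ((-1 : ℚ) ^ (r * (k + N))) ^ B * (-1) ^ (N * (B + 1) + 1) with hS
  set CORE := (-1) ^ N * (N ! : ℚ) * Dm ^ 3 * Dp ^ 2 *
    ((Dm ^ 2 * Dp ^ 2) ^ M * ((-1) ^ N * Dp * Dm * nf ^ (2 * r)) ^ B) * G with hCORE
  set W := -((-1 : ℚ) ^ (r * (k + N))) ^ B * G * (Dm * Dp) ^ (2 * M + 3 + B) * nf ^ (2 * B * r) * (N ! : ℚ) with hW
  linear_combination (S * nf * CORE) * c7 +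
    (((-1 : ℚ) ^ (r * (k + N))) ^ B *
      (nf * Dp * (N ! : ℚ) * Dm ^ 3 * Dp ^ 2 * (Dm ^ 2 * Dp ^ 2) ^ M * Dp ^ B * Dm ^ B * (nf ^ (2 * r)) ^ B * G)) * hsgn -
    W * hch - (W * ((((k + N).choose k : ℕ) : ℚ)) * (k ! : ℚ)) * bp

/-- **`gTailEven` in brick form** (`k ≥ 1`, `r ≥ 1`, `B = b+1 ≥ 1`, `|ε| < 1/2`):
`gTailEven = −((−1)^{rn})^B · R(k,0;1−ε) · gSumK(even)`.
[cite: KrattenthalerRivoal2007, §13 proof of Proposition 7 (even A, (eq:briques))] -/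
theorem gTailEven_eq_bricks (k N M b r : ℕ) (hk : 1 ≤ k) (hr : 1 ≤ r) {ε : ℚ} (h1 : ε < 1 / 2) (h2 : -(1 / 2) < ε) :
    gTailEven k N M (b + 1) r ε = -((-1 : ℚ) ^ (r * (k + N))) ^ (b + 1) * polyBrick 1 k (-ε) *
      gSumK k N r M (b + 1) false ε := by
  obtain ⟨hDm, hDp⟩ := norms_ne_zero h1 h2 (k + N)
  have hnf : ((k + N)! : ℚ) ≠ 0 := by positivity
  have hNf : (N ! : ℚ) ≠ 0 := by positivity
  have hkf : (k ! : ℚ) ≠ 0 := by positivity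
  have hy := rawK_dict_even_y k N r hr ε b
  have hx := rawK_dict_x k N r false (b + 1) h1 h2 (fun i hi => hy i hi)
  have hcore := core_eq_gSumK k N r M (b + 1) false hk h1 h2 (fun j hj => hx M j hj)
  have hsgn : (-1 : ℚ) ^ (N * (b + 1 + 1) + 1) * ((-1) ^ N * (-1) ^ (N * (b + 1))) = -1 := by
    rw [← pow_add, ← pow_add, show N * (b + 1 + 1) + 1 + (N + N * (b + 1)) = 2 * (N * (b + 1 + 1)) + 1 by ring,
      pow_add, pow_mul, neg_one_sq, one_pow, one_mul, pow_one]
  unfold gTailEven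
  rw [← linkReducedMultiSum_map_some, corOneParamsK_map_eq_chainK]
  set red := linkReducedMultiSum (-(N : ℚ) + k - 2 * ε)
    ((-(N : ℚ) - ε, some 1) :: (-(N : ℚ) - ε, some (1 + (k : ℚ) - 2 * ε)) :: chainK k N r false M (b + 1) ε) N
  set Dm := ∏ l ∈ range (k + N), (1 - ε + (l : ℚ))
  set Dp := ∏ l ∈ range (k + N), (1 + ε + (l : ℚ))
  set Rm := ∏ l ∈ range (r * (k + N)), (1 - ε + (l : ℚ))
  set Rp := ∏ l ∈ range (r * (k + N)), (1 + ε + (l : ℚ))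
  set P := ∏ i' ∈ range k, (1 + ε + (N : ℚ) + i')
  set Q := ∏ i' ∈ range k, (((r * (k + N) : ℕ) : ℚ) + 1 - ε + i')
  set nf := ((k + N)! : ℚ)
  set G := gSumK k N r M (b + 1) false ε
  set pB := polyBrick 1 k (-ε)
  have hK : (Dm * Dp) ^ (2 * M + 2 + (b + 1)) * nf ^ (2 * (b + 1) * r) * (N ! : ℚ) * (k ! : ℚ) ≠ 0 := by
    apply_rules [mul_ne_zero, pow_ne_zero]
  apply mul_right_cancel₀ hK
  have eg : ((-1 : ℚ) ^ (r * (k + N))) ^ (b + 1) * (-1) ^ (N * (b + 1 + 1) + 1) *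
      (nf ^ (2 * M + 2) * (Rm * Rp) ^ (b + 1) * P ^ (2 * M + 2 + (b + 1)) * Q ^ (b + 1) /
        ((Dm * Dp) ^ (2 * M + 2 + (b + 1)) * nf ^ (2 * (b + 1) * r) * (N ! : ℚ))) *
      red * ((Dm * Dp) ^ (2 * M + 2 + (b + 1)) * nf ^ (2 * (b + 1) * r) * (N ! : ℚ) * (k ! : ℚ)) =
      ((-1 : ℚ) ^ (r * (k + N))) ^ (b + 1) * (-1) ^ (N * (b + 1 + 1) + 1) *
        (red * (nf ^ 2 * P ^ 2 * (k ! : ℚ)) * ((nf ^ 2 * P ^ 2) ^ M * ((Rm * Q) * (Rp * P)) ^ (b + 1))) := by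
    field_simp
    ring
  rw [eg, hcore]
  linear_combination (((-1 : ℚ) ^ (r * (k + N))) ^ (b + 1) *
      ((N ! : ℚ) * Dm ^ 3 * Dp ^ 2 * (Dm ^ 2 * Dp ^ 2) ^ M * ((k ! : ℚ) * pB) * nf ^ (2 * r * (b + 1)) *
        Dp ^ (b + 1) * Dm ^ b * G)) * hsgn

/-! ### Integrality of the tail multiple sums -/

/-- **`gTailOdd` is `IsDInt (d_n)` at `0` to all orders** (`k ≥ 1`, `r ≥ 1`, every `B ≥ 0`): the odd-`A` half of
KR's Proposition 7 in the tree's normal form. [cite: KrattenthalerRivoal2007, §13 Proposition 7 and its proof (A odd)] -/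
theorem gTailOdd_isDInt (k N M B r : ℕ) (hk : 1 ≤ k) (hr : 1 ≤ r) (N' : ℕ) :
    IsDInt (Nat.lcmUpto (k + N)) N' (gTailOdd k N M B r) 0 := by
  have h0 : IsDInt (Nat.lcmUpto (k + N)) N'
      (fun _ : ℚ => (((-((-1 : ℤ) ^ (r * (k + N))) ^ B * (((k + N).choose k : ℕ) : ℤ)) : ℤ) : ℚ)) 0 := IsDInt.const _ N' _ 0
  have h := (h0.mul (rbPlus_isDInt (n := k + N) (i := N) (by omega) N')).mul (gSumK_isDInt hk hr M B true N')
  refine h.congr ?_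
  have e1 : ∀ᶠ ε in nhds (0 : ℚ), ε < 1 / 2 := eventually_lt_nhds (by norm_num)
  have e2 : ∀ᶠ ε in nhds (0 : ℚ), -(1 / 2) < ε := eventually_gt_nhds (by norm_num)
  filter_upwards [e1, e2] with ε hε1 hε2
  rw [gTailOdd_eq_bricks k N M B r hk hr hε1 hε2]
  push_cast
  ring

/-- **`gTailEven` is `IsDInt (d_n)` at `0` to all orders** (`k ≥ 1`, `r ≥ 1`, `B ≥ 1`): the even-`A` half of KR's
Proposition 7 in the tree's normal form. [cite: KrattenthalerRivoal2007, §13 Proposition 7 and its proof (A even)] -/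
theorem gTailEven_isDInt (k N M B r : ℕ) (hk : 1 ≤ k) (hr : 1 ≤ r) (hB : 1 ≤ B) (N' : ℕ) :
    IsDInt (Nat.lcmUpto (k + N)) N' (gTailEven k N M B r) 0 := by
  obtain ⟨b, rfl⟩ : ∃ b, B = b + 1 := ⟨B - 1, by omega⟩
  have h0 : IsDInt (Nat.lcmUpto (k + N)) N' (fun _ : ℚ => (((-((-1 : ℤ) ^ (r * (k + N))) ^ (b + 1)) : ℤ) : ℚ)) 0 :=
    IsDInt.const _ N' _ 0
  have h := (h0.mul (polyBrick_neg_eps_isDInt 1 (m := k) (n := k + N) (by omega) N')).mul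
    (gSumK_isDInt hk hr M (b + 1) false N')
  refine h.congr ?_
  have e1 : ∀ᶠ ε in nhds (0 : ℚ), ε < 1 / 2 := eventually_lt_nhds (by norm_num)
  have e2 : ∀ᶠ ε in nhds (0 : ℚ), -(1 / 2) < ε := eventually_gt_nhds (by norm_num)
  filter_upwards [e1, e2] with ε hε1 hε2
  rw [gTailEven_eq_bricks k N M b r hk hr hε1 hε2]
  push_cast
  ring


/-! ### The case `B = 0` (used for `r = 0`) and Théorème 1 -/

/-- The even empty base in dictionary form: `(1−ε)_n · rawK(false,0,0,i) = (k!·R(k,0;1−ε)) · xWin(i) · innerK(false,0,0,i)`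
(both sides vanish unless `i = 0`, where `xWin(0)·(1−ε)_k = (1−ε)_n`). [cite: KrattenthalerRivoal2007, §13 (eq:briques), B = 0] -/
theorem rawK_dict_even_base (k N r : ℕ) (ε : ℚ) : ∀ i, i ≤ N →
    (∏ l ∈ range (k + N), (1 - ε + (l : ℚ))) * rawK k N r false 0 0 i ε =
      ((k ! : ℚ) * polyBrick 1 k (-ε)) * xWinK k N i ε * innerK k N r false 0 0 i ε := by
  intro i hi
  rw [rawK_base_even, innerK_base]
  simp only [Bool.false_eq_true, ↓reduceIte]
  split_ifs with h
  · subst h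
    have hx := xWinK_mul (k := k) (Nat.zero_le N) ε
    rw [Nat.add_zero] at hx
    have hpb : (k ! : ℚ) * polyBrick 1 k (-ε) = pw (1 - ε) k := by
      unfold polyBrick
      rw [mul_div_cancel₀ _ (by positivity : (k ! : ℚ) ≠ 0), ← pw_def]
      exact pw_congr (by push_cast; ring) _
    rw [hpb, ← pw_def, ← hx]
    ring
  · simp

/-- **`gTailEven` in brick form for `B = 0`** (`k ≥ 1`, `|ε| < 1/2`): `gTailEven(…,0,r) = −R(k,0;1−ε) · gSumK(even, B=0)`.
[cite: KrattenthalerRivoal2007, §13 proof of Proposition 7 (B = 0)] -/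
theorem gTailEven_eq_bricks_zero (k N M r : ℕ) (hk : 1 ≤ k) {ε : ℚ} (h1 : ε < 1 / 2) (h2 : -(1 / 2) < ε) :
    gTailEven k N M 0 r ε = -(polyBrick 1 k (-ε)) * gSumK k N r M 0 false ε := by
  obtain ⟨hDm, hDp⟩ := norms_ne_zero h1 h2 (k + N)
  have hnf : ((k + N)! : ℚ) ≠ 0 := by positivity
  have hNf : (N ! : ℚ) ≠ 0 := by positivity
  have hkf : (k ! : ℚ) ≠ 0 := by positivity
  have hx := rawK_dict_x k N r false 0 h1 h2 (rawK_dict_even_base k N r ε)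
  have hcore := core_eq_gSumK k N r M 0 false hk h1 h2 (fun j hj => hx M j hj)
  unfold gTailEven
  rw [← linkReducedMultiSum_map_some, corOneParamsK_map_eq_chainK]
  set red := linkReducedMultiSum (-(N : ℚ) + k - 2 * ε)
    ((-(N : ℚ) - ε, some 1) :: (-(N : ℚ) - ε, some (1 + (k : ℚ) - 2 * ε)) :: chainK k N r false M 0 ε) N
  set Dm := ∏ l ∈ range (k + N), (1 - ε + (l : ℚ))
  set Dp := ∏ l ∈ range (k + N), (1 + ε + (l : ℚ))
  set Rm := ∏ l ∈ range (r * (k + N)), (1 - ε + (l : ℚ))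
  set Rp := ∏ l ∈ range (r * (k + N)), (1 + ε + (l : ℚ))
  set P := ∏ i' ∈ range k, (1 + ε + (N : ℚ) + i')
  set Q := ∏ i' ∈ range k, (((r * (k + N) : ℕ) : ℚ) + 1 - ε + i')
  set nf := ((k + N)! : ℚ)
  set G := gSumK k N r M 0 false ε
  set pB := polyBrick 1 k (-ε)
  have hK : (Dm * Dp) ^ (2 * M + 2 + 0) * nf ^ (2 * 0 * r) * (N ! : ℚ) * ((k ! : ℚ) * Dm) ≠ 0 := by
    apply_rules [mul_ne_zero, pow_ne_zero]
  apply mul_right_cancel₀ hK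
  have eg : ((-1 : ℚ) ^ (r * (k + N))) ^ 0 * (-1) ^ (N * (0 + 1) + 1) *
      (nf ^ (2 * M + 2) * (Rm * Rp) ^ 0 * P ^ (2 * M + 2 + 0) * Q ^ 0 /
        ((Dm * Dp) ^ (2 * M + 2 + 0) * nf ^ (2 * 0 * r) * (N ! : ℚ))) *
      red * ((Dm * Dp) ^ (2 * M + 2 + 0) * nf ^ (2 * 0 * r) * (N ! : ℚ) * ((k ! : ℚ) * Dm)) =
      (-1) ^ (N + 1) * (red * (nf ^ 2 * P ^ 2 * (k ! : ℚ)) * ((nf ^ 2 * P ^ 2) ^ M * Dm)) := by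
    field_simp
    ring
  rw [eg, hcore]
  have hsgn : (-1 : ℚ) ^ (N + 1) * (-1) ^ N = -1 := by
    rw [← pow_add, show N + 1 + N = 2 * N + 1 by ring, pow_add, pow_mul, neg_one_sq, one_pow, one_mul, pow_one]
  linear_combination ((N ! : ℚ) * Dm ^ 3 * Dp ^ 2 * ((Dm ^ 2 * Dp ^ 2) ^ M * ((k ! : ℚ) * pB)) * G) * hsgn

/-- **`gTailEven` with `B = 0` is `IsDInt (d_n)` at `0`** (`k ≥ 1`; stated with `r ≥ 1` for the shared lemmas).
[cite: KrattenthalerRivoal2007, §13 Proposition 7 (B = 0)] -/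
theorem gTailEven_isDInt_zero (k N M r : ℕ) (hk : 1 ≤ k) (hr : 1 ≤ r) (N' : ℕ) :
    IsDInt (Nat.lcmUpto (k + N)) N' (gTailEven k N M 0 r) 0 := by
  have h := ((polyBrick_neg_eps_isDInt 1 (m := k) (n := k + N) (by omega) N').neg).mul (gSumK_isDInt hk hr M 0 false N')
  refine h.congr ?_
  have e1 : ∀ᶠ ε in nhds (0 : ℚ), ε < 1 / 2 := eventually_lt_nhds (by norm_num)
  have e2 : ∀ᶠ ε in nhds (0 : ℚ), -(1 / 2) < ε := eventually_gt_nhds (by norm_num)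
  filter_upwards [e1, e2] with ε hε1 hε2
  rw [gTailEven_eq_bricks_zero k N M r hk hε1 hε2]

/-- At `B = 0` the tail sums do not depend on `r` (even). [cite: KrattenthalerRivoal2007, §13 (R_{n,A,0,r} = R_{n,A,0,0})] -/
theorem gTailEven_zero_B_zero_r (k N M : ℕ) (ε : ℚ) : gTailEven k N M 0 0 ε = gTailEven k N M 0 1 ε := by
  simp [gTailEven, corOneParamsK]

/-- At `B = 0` the tail sums do not depend on `r` (odd). [cite: KrattenthalerRivoal2007, §13] -/
theorem gTailOdd_zero_B_zero_r (k N M : ℕ) (ε : ℚ) : gTailOdd k N M 0 0 ε = gTailOdd k N M 0 1 ε := by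
  simp [gTailOdd, corTwoParamsK]

/-- At `r = 0` the numerator polynomial of `R_{n,A,B,r}` is that of `B = 0`. [cite: KrattenthalerRivoal2007, §2.4 (eq:R)] -/
theorem numeratorR_zero_r (n A B : ℕ) : numeratorR n A B 0 = numeratorR n A 0 0 := by
  simp [numeratorR]

/-- Partial-fraction data at `r = 0` are partial-fraction data for `B = 0`. [cite: KrattenthalerRivoal2007, §2.4 (eq:p_l)] -/
theorem isPartialFractionData_zero_r {n A B : ℕ} {c : ℕ → ℕ → ℚ} (hc : IsPartialFractionData n A B 0 c) :
    IsPartialFractionData n A 0 0 c := by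
  intro t ht
  rw [hc t ht, numeratorR_zero_r, numeratorR_zero_r n A 0]

/-- **[KrattenthalerRivoal2007, Théorème 1] holds**: the named fact `theoreme1` (the arithmetic of the coefficient
polynomials of `R_{n,A,B,r}`: (i) `d_n^{A−l−1} p_{l,n}((−1)^A) ∈ ℤ`, (ii) `2 d_n^{A+C−1} p_{0,C,n}((−1)^A) ∈ ℤ`) is a theorem:
clause (i) by Proposition 6 (`theoreme1_i`), clause (ii) by Proposition 7 = the integrality of the tail multiple sums
(`gTailEven_isDInt`, `gTailOdd_isDInt`; `r = 0` through `B = 0`). [cite: KrattenthalerRivoal2007, §2.4 Théorème 1; §§12–13] -/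
theorem theoreme1_holds : Literature.NumberTheory.Irrationality.KrattenthalerRivoal2007.theoreme1 := by
  refine theoreme1_of_prop7 fun n A B r hA hB c hc i hi1 hin e he1 heA => ?_
  obtain ⟨N, rfl⟩ : ∃ N, n = i + N := ⟨n - i, by omega⟩
  obtain ⟨M, hM | hM⟩ := Nat.even_or_odd' A
  · obtain ⟨M', rfl⟩ : ∃ M', A = 2 * M' + 2 := ⟨M - 1, by omega⟩
    rcases Nat.eq_zero_or_pos r with hr | hr
    · subst hr
      refine prop7_even_of_isDInt i N M' 0 0 hi1 (fun N' => ?_) c (isPartialFractionData_zero_r hc) e he1 heA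
      have h := gTailEven_isDInt_zero i N M' 1 hi1 le_rfl N'
      exact h.congr (Eventually.of_forall fun ε => (gTailEven_zero_B_zero_r i N M' ε).symm)
    · exact prop7_even_of_isDInt i N M' B r hi1 (gTailEven_isDInt i N M' B r hi1 hr hB) c hc e he1 heA
  · obtain ⟨M', rfl⟩ : ∃ M', A = 2 * M' + 3 := ⟨M - 1, by omega⟩
    rcases Nat.eq_zero_or_pos r with hr | hr
    · subst hr
      refine prop7_odd_of_isDInt i N M' 0 0 hi1 (fun N' => ?_) c (isPartialFractionData_zero_r hc) e he1 heA
      have h := gTailOdd_isDInt i N M' 0 1 hi1 le_rfl N'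
      exact h.congr (Eventually.of_forall fun ε => (gTailOdd_zero_B_zero_r i N M' ε).symm)
    · exact prop7_odd_of_isDInt i N M' B r hi1 (gTailOdd_isDInt i N M' B r hi1 hr) c hc e he1 heA

end Literature.NumberTheory.Irrationality.KrattenthalerRivoal2007
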